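import Literature.NumberTheory.Transcendental.MasserThmIMain
import Mathlib.Analysis.SpecialFunctions.Pow.Asymptotics
import HarnessLib

/-!
# Masser 1975, Theorem I — the choice of parameters (asymptotics) and the statement

Support for the proof of Theorem I of D. W. Masser, *Elliptic Functions and Transcendence*,
LNM 437 (1975), Ch. I §1.3, on the book's own line towards Theorem II
(`Literature.NumberTheory.Transcendental.masser_ellipticPeriods`).

`MasserThmIMain.lean` reduces Theorem I to the existence, for `H ≥ H₀(ε)`, of integer parameters
satisfying the finitely many inequalities `Run.Hyp`. Here: the generic asymptotic tools
(`eventually_mul_rpow_le_rpow`, `eventually_log_le_rpow`, `eventually_mul_rpow_lt_exp`, floors)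
and the inequalities between Masser's exponents `a = 2+40δ`, `b = a(½+δ)`, `g = a(½-2δ)`,
`a₁ = a(1+6δ)`, `g₁ = a(½+2δ)` (`δ = ε/100`; `k = [ℓ^a]`, `L = [ℓ^b]`, `h = [ℓ^g]`,
`k₁ = [ℓ^{a₁}]`, `h₁ = [ℓ^{g₁}]`, `ℓ = log H`). The verification of `Run.Hyp` and the statement
of Theorem I are the sequel.

Everything here is proved; no named facts.

## References

* D. W. Masser, *Elliptic Functions and Transcendence*, Lecture Notes in Math. 437, Springer 1975,
  Ch. I §1.3 (p. 5: the parameters `δ = ε/100`, `k`, `L`, `h`; pp. 8–9: `k₁`, `h₁`). [Masser1975]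
-/

noncomputable section

open Real Filter Asymptotics

namespace Literature.NumberTheory.Transcendental.Masser1975

/-! ### Generic asymptotic tools -/

/-- `c x^{e₁} ≤ x^{e₂}` eventually, for `e₁ < e₂`. [folklore] -/
theorem eventually_mul_rpow_le_rpow (c : ℝ) {e₁ e₂ : ℝ} (h : e₁ < e₂) :
    ∀ᶠ x in atTop, c * x ^ e₁ ≤ x ^ e₂ := by
  have ht := tendsto_rpow_atTop (sub_pos.mpr h)
  filter_upwards [ht.eventually_ge_atTop c, eventually_ge_atTop (1 : ℝ)] with x hx hx1
  have hx0 : 0 < x := by linarith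
  calc c * x ^ e₁ ≤ x ^ (e₂ - e₁) * x ^ e₁ :=
        mul_le_mul_of_nonneg_right hx (rpow_nonneg hx0.le _)
    _ = x ^ e₂ := by rw [← rpow_add hx0]; ring_nf

/-- `log(A x^e + A) ≤ x^δ` eventually, for `A ≥ 1`, `e ≥ 0`, `δ > 0`. [folklore] -/
theorem eventually_log_le_rpow {δ : ℝ} (hδ : 0 < δ) {A e : ℝ} (hA : 1 ≤ A) (he : 0 ≤ e) :
    ∀ᶠ x in atTop, Real.log (A * x ^ e + A) ≤ x ^ δ := by
  have ho := (isLittleO_log_rpow_atTop (half_pos hδ)).bound one_pos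
  have h2 := eventually_mul_rpow_le_rpow (Real.log (2 * A) + e) (by linarith : δ / 2 < δ)
  filter_upwards [ho, h2, eventually_ge_atTop (1 : ℝ)] with x hx hx2 hx1
  have hx0 : 0 < x := by linarith
  have hlogx : 0 ≤ Real.log x := Real.log_nonneg hx1
  have hxe : 1 ≤ x ^ e := one_le_rpow hx1 he
  have hlog_le : Real.log x ≤ x ^ (δ / 2) := by
    have h := hx
    simp only [norm_eq_abs, one_mul] at h
    rwa [abs_of_nonneg hlogx, abs_of_nonneg (rpow_nonneg hx0.le _)] at h
  have hA0 : 0 < A := by linarith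
  have harg : A * x ^ e + A ≤ 2 * A * x ^ e := by nlinarith
  have hpos : 0 < A * x ^ e + A := by positivity
  have hl2A : 0 ≤ Real.log (2 * A) := Real.log_nonneg (by linarith)
  have hxδ : 1 ≤ x ^ (δ / 2) := one_le_rpow hx1 (by linarith)
  calc Real.log (A * x ^ e + A) ≤ Real.log (2 * A * x ^ e) := Real.log_le_log hpos harg
    _ = Real.log (2 * A) + e * Real.log x := by
        rw [Real.log_mul (by positivity) (by positivity), Real.log_rpow hx0]
    _ ≤ Real.log (2 * A) + e * x ^ (δ / 2) := by gcongr
    _ ≤ (Real.log (2 * A) + e) * x ^ (δ / 2) := by nlinarith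
    _ ≤ x ^ δ := hx2

/-- `C x^e < exp x` eventually. [folklore] -/
theorem eventually_mul_rpow_lt_exp (C e : ℝ) : ∀ᶠ x in atTop, C * x ^ e < Real.exp x := by
  have ht := tendsto_exp_div_rpow_atTop e
  filter_upwards [ht.eventually_gt_atTop C, eventually_gt_atTop (0 : ℝ)] with x hx hx0
  rwa [lt_div_iff₀ (rpow_pos_of_pos hx0 e)] at hx

/-- Floors of reals `≥ 2` are comparable to the real: `x/2 ≤ ⌊x⌋₊ ≤ x`. [folklore] -/
theorem floor_sandwich {x : ℝ} (hx : 2 ≤ x) : x / 2 ≤ (⌊x⌋₊ : ℝ) ∧ (⌊x⌋₊ : ℝ) ≤ x := by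
  constructor
  · have := Nat.sub_one_lt_floor x
    linarith
  · exact Nat.floor_le (by linarith)

/-! ### Masser's exponents -/

section Exponents

variable (ε : ℝ)

/-- `δ = ε/100`. [cite: Masser1975, §1.3 (p. 5)] -/
def dδ : ℝ := ε / 100
/-- `a = 2 + 40δ` (`k = [ℓ^a]`). [cite: Masser1975, §1.3 (p. 5)] -/
def ea : ℝ := 2 + 40 * dδ ε
/-- `b = a(½ + δ)` (`L = [k^{½+δ}] = [ℓ^b]`). [cite: Masser1975, §1.3 (p. 5)] -/
def eb : ℝ := ea ε * (1 / 2 + dδ ε)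
/-- `g = a(½ - 2δ)` (`h = [k^{½-2δ}]`). [cite: Masser1975, §1.3 (proof of Lemma 1.10, (11))] -/
def eg : ℝ := ea ε * (1 / 2 - 2 * dδ ε)
/-- `a₁ = a(1 + 6δ)` (`k₁ = [k^{1+6δ}]`). [cite: Masser1975, §1.3 (proof of Lemma 1.10)] -/
def ea₁ : ℝ := ea ε * (1 + 6 * dδ ε)
/-- `g₁ = a(½ + 2δ)` (`h₁ = [k^{½+2δ}]`). [cite: Masser1975, §1.3 (proof of Lemma 1.11, (15))] -/
def eg₁ : ℝ := ea ε * (1 / 2 + 2 * dδ ε)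
/-- The smallness exponent `3 + ε = 3 + 100δ`. [cite: Masser1975, Thm I] -/
def eE : ℝ := 3 + ε

variable {ε}

/-- The range of `δ`. [folklore] -/
theorem dδ_bounds (hε : 0 < ε) (hε1 : ε ≤ 1 / 2) : 0 < dδ ε ∧ dδ ε ≤ 1 / 200 := by
  unfold dδ; constructor <;> linarith

/-- **The inequalities between the exponents** used in the verification of `Run.Hyp`
(all margins are `O(δ)`; e.g. `a + g - (a₁ + 1) = 4δ - 320δ²`). [cite: Masser1975, §1.3] -/
theorem exps_facts (hε : 0 < ε) (hε1 : ε ≤ 1 / 2) :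
    1 < eg ε ∧ eb ε + eg ε < ea ε ∧ ea ε < 2 * eb ε ∧ eb ε < eg₁ ε ∧ eb ε + eg₁ ε < ea₁ ε ∧
    ea ε ≤ ea₁ ε ∧ ea₁ ε + 1 < ea ε + eg ε ∧ ea ε + 1 < ea ε + eg ε ∧
    eb ε + 2 * eg ε < ea ε + eg ε ∧
    ea₁ ε + eg₁ ε + dδ ε < eE ε ∧ eb ε + 2 * eg₁ ε < eE ε ∧ ea ε + 1 < eE ε ∧
    ea ε + eg ε + dδ ε < eE ε ∧ eb ε + 2 * eg ε < eE ε ∧ ea₁ ε + dδ ε < eE ε ∧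
    ea₁ ε + 1 < eE ε ∧
    3 * eb ε < ea₁ ε + eg₁ ε ∧ ea ε + 1 < ea₁ ε + eg₁ ε ∧ eb ε + 1 < ea₁ ε + eg₁ ε ∧
    eb ε + 2 * eg₁ ε < ea₁ ε + eg₁ ε ∧
    0 < dδ ε ∧ 0 < eb ε ∧ 0 < eg ε ∧ 0 < ea ε ∧ 0 < ea₁ ε ∧ 0 < eg₁ ε := by
  obtain ⟨hd0, hd1⟩ := dδ_bounds hε hε1
  have hE : eE ε = 3 + 100 * dδ ε := by unfold eE dδ; ring
  simp only [eb, eg, ea₁, eg₁]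
  simp only [ea]
  rw [hE]
  set d := dδ ε with hd
  refine ⟨?_, ?_, ?_, ?_, ?_, ?_, ?_, ?_, ?_, ?_, ?_, ?_, ?_, ?_, ?_, ?_, ?_, ?_, ?_, ?_, hd0, ?_, ?_, ?_, ?_, ?_⟩ <;>
    nlinarith [sq_nonneg d, mul_pos hd0 hd0]

end Exponents

/-! ### The fixed data and the master constant -/

/-- The fixed data of Theorem I: the lattice data `S`, its constants `K`, and `ε`. [cite: Masser1975, Thm I] -/
structure PData where
  /-- lattice with algebraic invariants -/
  S : TSetup
  /-- the constants of the lattice -/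
  K : Consts S.L
  /-- the exponent `ε` -/
  ε : ℝ
  hε : 0 < ε
  hε1 : ε ≤ 1 / 2

namespace PData

variable (D : PData)

/-- `τ`, `T = |τ| + 1`, `T₁`, `T₀` of the lattice (as in `Run`). [folklore] -/
def T : ℝ := ‖D.S.L.ω₂ / D.S.L.ω₁‖ + 1

/-- **The master constant** `Cb ≥ 10` dominating the logarithms of all the constants of the
proof. [cite: Masser1975, §1.3 ("c, c₁, … depend only on ω₁, ω₂, d and ε")] -/
def Cb : ℝ := 10 + Real.log D.S.C₀ + Real.log (siegelConst D.S.K) + D.S.G.h + D.K.CG + D.K.Cσ +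
  |Real.log D.K.cσ| + D.K.Cu + D.K.C₁₀ + |Real.log D.K.κ| + D.K.R + Real.log D.K.d.ρ⁻¹ +
  Real.log D.T + Real.log (max 1 ‖D.S.L.ω₁‖) + Real.log (max 1 ‖D.S.L.ω₁‖⁻¹) +
  |Real.log ‖D.S.L.ω₁‖| + Real.log D.S.G.M + D.K.N₀

/-- The summands of `Cb` are non-negative; `Cb ≥ 10`. [folklore] -/
theorem ten_le_Cb : 10 ≤ D.Cb := by
  unfold Cb
  have h1 : 0 ≤ Real.log D.S.C₀ := Real.log_nonneg D.S.one_le_C₀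
  have h2 : 0 ≤ Real.log (siegelConst D.S.K) := Real.log_nonneg (one_le_siegelConst _)
  have h3 : 0 ≤ (D.S.G.h : ℝ) := Nat.cast_nonneg _
  have h4 := D.K.hCG0
  have h5 := D.K.hCσ
  have h6 : 0 ≤ |Real.log D.K.cσ| := abs_nonneg _
  have h7 := D.K.hCu0
  have h8 : 0 ≤ (D.K.C₁₀ : ℝ) := Nat.cast_nonneg _
  have h9 : 0 ≤ |Real.log D.K.κ| := abs_nonneg _
  have h10 := D.K.hR.le
  have h11 : 0 ≤ Real.log D.K.d.ρ⁻¹ := Real.log_nonneg (one_le_inv₀ D.K.d.ρ_pos |>.mpr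
    (D.K.d.ρ_le.trans (by norm_num)))
  have h12 : 0 ≤ Real.log D.T := Real.log_nonneg (by unfold T; have := norm_nonneg (D.S.L.ω₂ / D.S.L.ω₁); linarith)
  have h13 : 0 ≤ Real.log (max 1 ‖D.S.L.ω₁‖) := Real.log_nonneg (le_max_left _ _)
  have h14 : 0 ≤ Real.log (max 1 ‖D.S.L.ω₁‖⁻¹) := Real.log_nonneg (le_max_left _ _)
  have h15 : 0 ≤ |Real.log ‖D.S.L.ω₁‖| := abs_nonneg _
  have h16 : 0 ≤ Real.log D.S.G.M := Real.log_nonneg D.S.G.one_le_M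
  have h17 : 0 ≤ (D.K.N₀ : ℝ) := Nat.cast_nonneg _
  linarith

/-- `1 ≤ Cb`. [folklore] -/
theorem one_le_Cb : 1 ≤ D.Cb := le_trans (by norm_num) D.ten_le_Cb

/-! ### The parameters as functions of `ℓ = log H` -/

/-- `k = [ℓ^a]`. [cite: Masser1975, §1.3 (p. 5)] -/
def kOf (ℓ : ℝ) : ℕ := ⌊ℓ ^ ea D.ε⌋₊
/-- `L = [ℓ^b]`. [cite: Masser1975, §1.3 (p. 5)] -/
def nOf (ℓ : ℝ) : ℕ := ⌊ℓ ^ eb D.ε⌋₊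
/-- `h = [ℓ^g]`. [cite: Masser1975, §1.3 (11)] -/
def hOf (ℓ : ℝ) : ℕ := ⌊ℓ ^ eg D.ε⌋₊
/-- `k₁ = [ℓ^{a₁}]`. [cite: Masser1975, §1.3 (proof of Lemma 1.10)] -/
def k₁Of (ℓ : ℝ) : ℕ := ⌊ℓ ^ ea₁ D.ε⌋₊
/-- `h₁ = [ℓ^{g₁}]`. [cite: Masser1975, §1.3 (15)] -/
def h₁Of (ℓ : ℝ) : ℕ := ⌊ℓ ^ eg₁ D.ε⌋₊

/-- **The atomic largeness conditions on `ℓ = log H`** from which all the inequalities of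
`Run.Hyp` follow (each holds eventually: `eventually_largeL`). [cite: Masser1975, §1.3 ("if H > c for some sufficiently large c")] -/
structure LargeL (ℓ : ℝ) : Prop where
  hℓ : 1 ≤ ℓ
  hlog : Real.log (21 * ℓ ^ ea₁ D.ε + 21) ≤ ℓ ^ dδ D.ε
  hexp : D.Cb * ℓ ^ eb D.ε < Real.exp ℓ
  -- floors are non-degenerate
  h2a : 2 ≤ ℓ ^ ea D.ε
  h2b : 2 * (D.K.N₀ + 1 : ℝ) ≤ ℓ ^ eb D.ε
  h2g : 2 ≤ ℓ ^ eg D.ε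
  h2a₁ : 2 ≤ ℓ ^ ea₁ D.ε
  h2g₁ : 2 ≤ ℓ ^ eg₁ D.ε
  -- the smallness `B = ℓ^{3+ε}` dominates
  hE1 : 350 * D.Cb * ℓ ^ (ea D.ε + eg D.ε + dδ D.ε) ≤ ℓ ^ eE D.ε
  hE2 : 350 * D.Cb * ℓ ^ (eb D.ε + 2 * eg D.ε) ≤ ℓ ^ eE D.ε
  hE3 : 350 * D.Cb ^ 2 * ℓ ^ (ea₁ D.ε + 1) ≤ ℓ ^ eE D.ε
  hE4 : 350 * D.Cb * ℓ ^ (ea₁ D.ε + eg₁ D.ε + dδ D.ε) ≤ ℓ ^ eE D.ε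
  hE5 : 350 * D.Cb * ℓ ^ (eb D.ε + 2 * eg₁ D.ε) ≤ ℓ ^ eE D.ε
  hE6 : 350 * D.Cb * ℓ ^ (ea₁ D.ε + dδ D.ε) ≤ ℓ ^ eE D.ε
  -- step 1 gain `ℓ^{a+g}` dominates
  hG1 : 3000 * D.Cb ^ 2 * ℓ ^ (ea D.ε + 1) ≤ ℓ ^ (ea D.ε + eg D.ε)
  hG2 : 40000 * D.Cb * ℓ ^ (eb D.ε + 2 * eg D.ε) ≤ ℓ ^ (ea D.ε + eg D.ε)
  hG3 : 40000 * D.Cb ^ 2 * ℓ ^ (ea₁ D.ε + 1) ≤ ℓ ^ (ea D.ε + eg D.ε)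
  -- step 2 gain `ℓ^{a₁+g₁}` dominates
  hH1 : 3000 * D.Cb ^ 2 * ℓ ^ (ea D.ε + 1) ≤ ℓ ^ (ea₁ D.ε + eg₁ D.ε)
  hH2 : 40000 * D.Cb * ℓ ^ (eb D.ε + 2 * eg₁ D.ε) ≤ ℓ ^ (ea₁ D.ε + eg₁ D.ε)
  hH3 : 4000 * D.Cb ^ 3 * ℓ ^ (3 * eb D.ε) ≤ ℓ ^ (ea₁ D.ε + eg₁ D.ε)
  hH4 : 4000 * D.Cb ^ 2 * ℓ ^ (eb D.ε + 1) ≤ ℓ ^ (ea₁ D.ε + eg₁ D.ε)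
  -- structural
  hS1 : 32 * ℓ ^ ea D.ε ≤ ℓ ^ (2 * eb D.ε)
  hS2 : 4 * D.Cb * ℓ ^ eb D.ε ≤ ℓ ^ eg₁ D.ε
  hS3 : 20 * D.Cb * ℓ ≤ ℓ ^ eE D.ε

/-- **All the largeness conditions hold for `ℓ` large.** [cite: Masser1975, §1.3 ("H > c")] -/
theorem eventually_largeL : ∀ᶠ ℓ in atTop, D.LargeL ℓ := by
  obtain ⟨hg1, hbga, ha2b, hbg₁, hbg₁a₁, haa₁, ha₁1ag, ha1ag, hb2gag, hE4', hE5', hE3a, hE1', hE2',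
    hE6', hE3', h3b, ha1, hb1, hb2g₁, hd0, hb0, hg0, ha0, ha₁0, hg₁0⟩ := exps_facts D.hε D.hε1
  have hCb := D.one_le_Cb
  have t := fun (c : ℝ) {e₁ e₂ : ℝ} (h : e₁ < e₂) => eventually_mul_rpow_le_rpow c h
  have tlog := eventually_log_le_rpow hd0 (A := 21) (e := ea₁ D.ε) (by norm_num) ha₁0.le
  have texp := eventually_mul_rpow_lt_exp D.Cb (eb D.ε)
  have t2 : ∀ {e : ℝ}, 0 < e → ∀ c : ℝ, ∀ᶠ x : ℝ in atTop, c ≤ x ^ e := fun he c =>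
    (tendsto_rpow_atTop he).eventually_ge_atTop c
  filter_upwards [eventually_ge_atTop (1 : ℝ), tlog, texp, t2 ha0 2, t2 hb0 (2 * (D.K.N₀ + 1 : ℝ)),
    t2 hg0 2, t2 ha₁0 2, t2 hg₁0 2,
    t (350 * D.Cb) (by linarith : ea D.ε + eg D.ε + dδ D.ε < eE D.ε),
    t (350 * D.Cb) (by linarith : eb D.ε + 2 * eg D.ε < eE D.ε),
    t (350 * D.Cb ^ 2) (by linarith : ea₁ D.ε + 1 < eE D.ε),
    t (350 * D.Cb) (by linarith : ea₁ D.ε + eg₁ D.ε + dδ D.ε < eE D.ε),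
    t (350 * D.Cb) (by linarith : eb D.ε + 2 * eg₁ D.ε < eE D.ε),
    t (350 * D.Cb) (by linarith : ea₁ D.ε + dδ D.ε < eE D.ε),
    t (3000 * D.Cb ^ 2) (by linarith : ea D.ε + 1 < ea D.ε + eg D.ε),
    t (40000 * D.Cb) (by linarith : eb D.ε + 2 * eg D.ε < ea D.ε + eg D.ε),
    t (40000 * D.Cb ^ 2) (by linarith : ea₁ D.ε + 1 < ea D.ε + eg D.ε),
    t (3000 * D.Cb ^ 2) (by linarith : ea D.ε + 1 < ea₁ D.ε + eg₁ D.ε),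
    t (40000 * D.Cb) (by linarith : eb D.ε + 2 * eg₁ D.ε < ea₁ D.ε + eg₁ D.ε),
    t (4000 * D.Cb ^ 3) (by linarith : 3 * eb D.ε < ea₁ D.ε + eg₁ D.ε),
    t (4000 * D.Cb ^ 2) (by linarith : eb D.ε + 1 < ea₁ D.ε + eg₁ D.ε),
    t 32 (by linarith : ea D.ε < 2 * eb D.ε),
    t (4 * D.Cb) (by linarith : eb D.ε < eg₁ D.ε),
    t (20 * D.Cb) (by unfold eE; linarith [D.hε] : (1 : ℝ) < eE D.ε)]
    with ℓ h1 h2 h3 h4 h5 h6 h7 h8 h9 h10 h11 h12 h13 h14 h15 h16 h17 h18 h19 h20 h21 h22 h23 h24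
  exact ⟨h1, h2, h3, h4, h5, h6, h7, h8, h9, h10, h11, h12, h13, h14, h15, h16, h17, h18, h19, h20, h21,
    h22, h23, by simpa using h24⟩

end PData

/-! ### Exp-calculus helpers -/

/-- `x ≤ e^B` from `log x ≤ B`. [folklore] -/
theorem le_exp_of_log_le {x B : ℝ} (hx : 0 < x) (h : Real.log x ≤ B) : x ≤ Real.exp B := by
  rw [← Real.exp_log hx]; exact Real.exp_le_exp.mpr h

/-- Products of exp-bounded non-negative reals. [folklore] -/
theorem mul_le_exp {x y a b : ℝ} (hx : 0 ≤ x) (h1 : x ≤ Real.exp a)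
    (h2 : y ≤ Real.exp b) : x * y ≤ Real.exp (a + b) := by
  rcases le_or_gt 0 y with hy | hy
  · rw [Real.exp_add]; exact mul_le_mul h1 h2 hy (Real.exp_nonneg _)
  · exact le_trans (mul_nonpos_of_nonneg_of_nonpos hx hy.le) (Real.exp_nonneg _)

/-- Powers of exp-bounded non-negative reals. [folklore] -/
theorem pow_le_exp {x a : ℝ} (hx : 0 ≤ x) (h : x ≤ Real.exp a) (m : ℕ) :
    x ^ m ≤ Real.exp (m * a) := by
  rw [Real.exp_nat_mul]; exact pow_le_pow_left₀ hx h m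

/-- Domination bookkeeping: with `K, Cb, x ≥ 1` and `0 ≤ m ≤ x`, every one of
`1, K, Cb, x, m, K Cb, K x, K m` is `≤ K Cb x`. [folklore] -/
theorem dom {K Cb x m : ℝ} (hK : 1 ≤ K) (hCb : 1 ≤ Cb) (hx : 1 ≤ x) (_hm0 : 0 ≤ m) (hm : m ≤ x) :
    1 ≤ K * Cb * x ∧ K ≤ K * Cb * x ∧ Cb ≤ K * Cb * x ∧ x ≤ K * Cb * x ∧ m ≤ K * Cb * x ∧
    K * Cb ≤ K * Cb * x ∧ K * x ≤ K * Cb * x ∧ K * m ≤ K * Cb * x := by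
  have h1 : 1 ≤ K * Cb := one_le_mul_of_one_le_of_one_le hK hCb
  have h2 : K * Cb ≤ K * Cb * x := le_mul_of_one_le_right (by positivity) hx
  have h3 : K ≤ K * Cb := le_mul_of_one_le_right (by positivity) hCb
  have h4 : Cb ≤ K * Cb := le_mul_of_one_le_left (by positivity) hK
  have h5 : x ≤ K * Cb * x := le_mul_of_one_le_left (by positivity) h1
  have h6 : K * x ≤ K * Cb * x := by nlinarith
  have h7 : K * m ≤ K * x := mul_le_mul_of_nonneg_left hm (by positivity)
  refine ⟨by nlinarith, by nlinarith, by nlinarith, h5, by nlinarith, h2, h6, by nlinarith⟩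

namespace PData

variable (D : PData)

/-- The smallness `E = e^{-(log H)^{3+ε}}`. [cite: Masser1975, Thm I] -/
def Esm (Q : QData) : ℝ := Real.exp (-(Real.log Q.H) ^ eE D.ε)

/-- **Masser's run** at the quadratic `Q`: parameters `k, L, h, k₁, h₁` as functions of
`ℓ = log H`. [cite: Masser1975, §1.3 (p. 5)] -/
def run (Q : QData) : Run where
  S := D.S
  Q := Q
  K := D.K
  E := D.Esm Q
  k := D.kOf (Real.log Q.H)
  n := D.nOf (Real.log Q.H)
  h := D.hOf (Real.log Q.H)
  k₁ := D.k₁Of (Real.log Q.H)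
  h₁ := D.h₁Of (Real.log Q.H)

/-- The exponent facts used below. [folklore] -/
theorem exps : 1 < eg D.ε ∧ eb D.ε + eg D.ε < ea D.ε ∧ ea D.ε < 2 * eb D.ε ∧ eb D.ε < eg₁ D.ε ∧
    eb D.ε + eg₁ D.ε < ea₁ D.ε ∧ ea D.ε ≤ ea₁ D.ε ∧ 0 < dδ D.ε ∧ dδ D.ε ≤ 1 / 200 ∧ 0 < eb D.ε := by
  obtain ⟨h1, h2, h3, h4, h5, h6, -, -, -, -, -, -, -, -, -, -, -, -, -, -, h7, h8, -⟩ :=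
    exps_facts D.hε D.hε1
  exact ⟨h1, h2, h3, h4, h5, h6, h7, (dδ_bounds D.hε D.hε1).2, h8⟩

section Bounds

variable {D} {ℓ : ℝ} (hL : D.LargeL ℓ)
include hL

/-! #### The parameters -/

/-- Auxiliary (`ℓ_pos`). [folklore] -/
theorem ℓ_pos : 0 < ℓ := lt_of_lt_of_le one_pos hL.hℓ

/-- Monotonicity of `ℓ^e` in `e` (`ℓ ≥ 1`). [folklore] -/
theorem rpow_mono {e₁ e₂ : ℝ} (h : e₁ ≤ e₂) : ℓ ^ e₁ ≤ ℓ ^ e₂ :=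
  Real.rpow_le_rpow_of_exponent_le hL.hℓ h

/-- Auxiliary (`one_le_rpow'`). [folklore] -/
theorem one_le_rpow' {e : ℝ} (he : 0 ≤ e) : 1 ≤ ℓ ^ e := Real.one_le_rpow hL.hℓ he

/-- `k ≤ ℓ^a`, `ℓ^a/2 ≤ k`, `1 ≤ k`. [folklore] -/
theorem k_bounds : (D.kOf ℓ : ℝ) ≤ ℓ ^ ea D.ε ∧ ℓ ^ ea D.ε / 2 ≤ D.kOf ℓ ∧ 1 ≤ D.kOf ℓ := by
  have h := floor_sandwich hL.h2a
  refine ⟨h.2, h.1, ?_⟩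
  have : (1 : ℝ) ≤ (⌊ℓ ^ ea D.ε⌋₊ : ℝ) := by linarith [h.1, hL.h2a]
  exact_mod_cast this

/-- `n ≤ ℓ^b`, `ℓ^b/2 ≤ n`, `N₀ + 1 ≤ n`. [folklore] -/
theorem n_bounds : (D.nOf ℓ : ℝ) ≤ ℓ ^ eb D.ε ∧ ℓ ^ eb D.ε / 2 ≤ D.nOf ℓ ∧ D.K.N₀ + 1 ≤ D.nOf ℓ := by
  have hN : (2 : ℝ) ≤ ℓ ^ eb D.ε := by
    have := hL.h2b; have : (0 : ℝ) ≤ D.K.N₀ := Nat.cast_nonneg _; linarith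
  have h := floor_sandwich hN
  refine ⟨h.2, h.1, ?_⟩
  have : ((D.K.N₀ + 1 : ℕ) : ℝ) ≤ (⌊ℓ ^ eb D.ε⌋₊ : ℝ) := by push_cast; linarith [h.1, hL.h2b]
  exact_mod_cast this

/-- `h ≤ ℓ^g`, `ℓ^g/2 ≤ h`, `1 ≤ h`. [folklore] -/
theorem h_bounds : (D.hOf ℓ : ℝ) ≤ ℓ ^ eg D.ε ∧ ℓ ^ eg D.ε / 2 ≤ D.hOf ℓ ∧ 1 ≤ D.hOf ℓ := by
  have h := floor_sandwich hL.h2g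
  refine ⟨h.2, h.1, ?_⟩
  have : (1 : ℝ) ≤ (⌊ℓ ^ eg D.ε⌋₊ : ℝ) := by linarith [h.1, hL.h2g]
  exact_mod_cast this

/-- `k₁ ≤ ℓ^{a₁}`, `ℓ^{a₁}/2 ≤ k₁`, `1 ≤ k₁`. [folklore] -/
theorem k₁_bounds : (D.k₁Of ℓ : ℝ) ≤ ℓ ^ ea₁ D.ε ∧ ℓ ^ ea₁ D.ε / 2 ≤ D.k₁Of ℓ ∧ 1 ≤ D.k₁Of ℓ := by
  have h := floor_sandwich hL.h2a₁
  refine ⟨h.2, h.1, ?_⟩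
  have : (1 : ℝ) ≤ (⌊ℓ ^ ea₁ D.ε⌋₊ : ℝ) := by linarith [h.1, hL.h2a₁]
  exact_mod_cast this

/-- `h₁ ≤ ℓ^{g₁}`, `ℓ^{g₁}/2 ≤ h₁`, `1 ≤ h₁`. [folklore] -/
theorem h₁_bounds : (D.h₁Of ℓ : ℝ) ≤ ℓ ^ eg₁ D.ε ∧ ℓ ^ eg₁ D.ε / 2 ≤ D.h₁Of ℓ ∧ 1 ≤ D.h₁Of ℓ := by
  have h := floor_sandwich hL.h2g₁
  refine ⟨h.2, h.1, ?_⟩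
  have : (1 : ℝ) ≤ (⌊ℓ ^ eg₁ D.ε⌋₊ : ℝ) := by linarith [h.1, hL.h2g₁]
  exact_mod_cast this

/-- `n ≤ k ≤ k₁` and `h, h₁, n, k ≤ ℓ^{a₁}`. [folklore] -/
theorem params_order : D.nOf ℓ ≤ D.kOf ℓ ∧ D.kOf ℓ ≤ D.k₁Of ℓ ∧ D.nOf ℓ ≤ D.k₁Of ℓ ∧
    (D.kOf ℓ : ℝ) ≤ ℓ ^ ea₁ D.ε ∧ (D.nOf ℓ : ℝ) ≤ ℓ ^ ea₁ D.ε ∧ (D.hOf ℓ : ℝ) ≤ ℓ ^ ea₁ D.ε ∧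
    (D.h₁Of ℓ : ℝ) ≤ ℓ ^ ea₁ D.ε := by
  obtain ⟨hg1, hbga, -, hbg₁, hbg₁a₁, haa₁, hd0, -, hb0⟩ := D.exps
  have hba : eb D.ε ≤ ea D.ε := by linarith
  have hnk : D.nOf ℓ ≤ D.kOf ℓ := Nat.floor_le_floor (rpow_mono hL hba)
  have hkk₁ : D.kOf ℓ ≤ D.k₁Of ℓ := Nat.floor_le_floor (rpow_mono hL haa₁)
  refine ⟨hnk, hkk₁, hnk.trans hkk₁, (k_bounds hL).1.trans (rpow_mono hL haa₁),
    (n_bounds hL).1.trans (rpow_mono hL (hba.trans haa₁)),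
    (h_bounds hL).1.trans (rpow_mono hL (by linarith)), (h₁_bounds hL).1.trans (rpow_mono hL (by linarith))⟩

/-- `1 ≤ ℓ^δ ≤ ℓ`. [folklore] -/
theorem ℓδ_bounds : 1 ≤ ℓ ^ dδ D.ε ∧ ℓ ^ dδ D.ε ≤ ℓ := by
  obtain ⟨-, -, -, -, -, -, hd0, hd1, -⟩ := D.exps
  refine ⟨one_le_rpow' hL hd0.le, ?_⟩
  calc ℓ ^ dδ D.ε ≤ ℓ ^ (1 : ℝ) := rpow_mono hL (by linarith)
    _ = ℓ := Real.rpow_one ℓ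

/-- **Small logarithms**: `log x ≤ ℓ^δ` whenever `0 < x ≤ 21 ℓ^{a₁} + 21`. [folklore] -/
theorem log_le_ℓδ {x : ℝ} (hx : 0 < x) (hx' : x ≤ 21 * ℓ ^ ea₁ D.ε + 21) :
    Real.log x ≤ ℓ ^ dδ D.ε :=
  (Real.log_le_log hx hx').trans hL.hlog

/-- The instances used: `log(7(2n+K+1))`, `log(K+1)`, `log(6 hh + 7)` for the parameters. [folklore] -/
theorem log_small {x : ℝ} (hx : 0 < x) {u v : ℝ} (hu : u ≤ ℓ ^ ea₁ D.ε) (hv : v ≤ ℓ ^ ea₁ D.ε)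
    (hx' : x ≤ 7 * (2 * u + v + 1)) : Real.log x ≤ ℓ ^ dδ D.ε :=
  log_le_ℓδ hL hx (by nlinarith)


/-! #### The constants are dominated by `Cb` -/

omit hL in
/-- Auxiliary (`consts_le_Cb`). [folklore] -/
theorem consts_le_Cb : Real.log D.S.C₀ ≤ D.Cb ∧ Real.log (siegelConst D.S.K) ≤ D.Cb ∧
    (D.S.G.h : ℝ) ≤ D.Cb ∧ D.K.CG ≤ D.Cb ∧ D.K.Cσ ≤ D.Cb ∧ |Real.log D.K.cσ| ≤ D.Cb ∧ D.K.Cu ≤ D.Cb ∧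
    (D.K.C₁₀ : ℝ) ≤ D.Cb ∧ |Real.log D.K.κ| ≤ D.Cb ∧ D.K.R ≤ D.Cb ∧ Real.log D.K.d.ρ⁻¹ ≤ D.Cb ∧
    Real.log D.T ≤ D.Cb ∧ Real.log (max 1 ‖D.S.L.ω₁‖) ≤ D.Cb ∧ Real.log (max 1 ‖D.S.L.ω₁‖⁻¹) ≤ D.Cb ∧
    |Real.log ‖D.S.L.ω₁‖| ≤ D.Cb ∧ Real.log D.S.G.M ≤ D.Cb ∧ (D.K.N₀ : ℝ) ≤ D.Cb := by
  have h1 : 0 ≤ Real.log D.S.C₀ := Real.log_nonneg D.S.one_le_C₀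
  have h2 : 0 ≤ Real.log (siegelConst D.S.K) := Real.log_nonneg (one_le_siegelConst _)
  have h3 : 0 ≤ (D.S.G.h : ℝ) := Nat.cast_nonneg _
  have h4 := D.K.hCG0
  have h5 := D.K.hCσ
  have h6 : 0 ≤ |Real.log D.K.cσ| := abs_nonneg _
  have h7 := D.K.hCu0
  have h8 : 0 ≤ (D.K.C₁₀ : ℝ) := Nat.cast_nonneg _
  have h9 : 0 ≤ |Real.log D.K.κ| := abs_nonneg _
  have h10 := D.K.hR.le
  have h11 : 0 ≤ Real.log D.K.d.ρ⁻¹ := Real.log_nonneg (one_le_inv₀ D.K.d.ρ_pos |>.mpr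
    (D.K.d.ρ_le.trans (by norm_num)))
  have h12 : 0 ≤ Real.log D.T := Real.log_nonneg (by unfold T; have := norm_nonneg (D.S.L.ω₂ / D.S.L.ω₁); linarith)
  have h13 : 0 ≤ Real.log (max 1 ‖D.S.L.ω₁‖) := Real.log_nonneg (le_max_left _ _)
  have h14 : 0 ≤ Real.log (max 1 ‖D.S.L.ω₁‖⁻¹) := Real.log_nonneg (le_max_left _ _)
  have h15 : 0 ≤ |Real.log ‖D.S.L.ω₁‖| := abs_nonneg _
  have h16 : 0 ≤ Real.log D.S.G.M := Real.log_nonneg D.S.G.one_le_M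
  have h17 : 0 ≤ (D.K.N₀ : ℝ) := Nat.cast_nonneg _
  unfold Cb
  refine ⟨?_, ?_, ?_, ?_, ?_, ?_, ?_, ?_, ?_, ?_, ?_, ?_, ?_, ?_, ?_, ?_, ?_⟩ <;> linarith

end Bounds

/-! #### Bounds for the explicit quantities of the run -/

section RunBounds

variable {D} {Q : QData} (hL : D.LargeL (Real.log Q.H))
include hL

set_option hygiene false in
local notation "ℓ" => Real.log (QData.H Q : ℝ)

omit hL in
/-- Auxiliary (`H_eq_exp`). [folklore] -/
theorem H_eq_exp : (Q.H : ℝ) = Real.exp ℓ := by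
  rw [Real.exp_log (by exact_mod_cast Q.one_le_H : (0 : ℝ) < Q.H)]

omit hL in
/-- Auxiliary (`run_E`). [folklore] -/
theorem run_E : (D.run Q).E = Real.exp (-ℓ ^ eE D.ε) := rfl

/-- `Amat(n, K) ≤ e^{10 Cb K ℓ}` for `n ≤ K ≤ ℓ^{a₁}`, `1 ≤ K`. [cite: Masser1975, §1.3 (Lemma 1.8, "H^{c₅k}")] -/
theorem Amat_le {K : ℕ} (hnK : D.nOf ℓ ≤ K) (hK1 : 1 ≤ K) (hKℓ : (K : ℝ) ≤ ℓ ^ ea₁ D.ε) :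
    D.S.Amat Q (D.nOf ℓ) K ≤ Real.exp (10 * D.Cb * K * ℓ) := by
  obtain ⟨hC0, -⟩ := consts_le_Cb (D := D)
  have hℓ := hL.hℓ
  have hCb := D.one_le_Cb
  obtain ⟨hδ1, hδℓ⟩ := ℓδ_bounds hL
  obtain ⟨-, -, -, -, hnℓ, -⟩ := params_order hL
  have hK : (1 : ℝ) ≤ K := by exact_mod_cast hK1
  have hnK' : (D.nOf ℓ : ℝ) ≤ K := by exact_mod_cast hnK
  have hC00 : 0 ≤ D.S.C₀ := zero_le_one.trans D.S.one_le_C₀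
  -- the three factors
  have f1 : D.S.C₀ ^ (2 * D.nOf ℓ + K) ≤ Real.exp (((2 * D.nOf ℓ + K : ℕ) : ℝ) * D.Cb) :=
    pow_le_exp (zero_le_one.trans D.S.one_le_C₀) (le_exp_of_log_le (by linarith [D.S.one_le_C₀]) hC0) _
  have f2 : (4 * (Q.H : ℝ) ^ 3) ^ K ≤ Real.exp ((K : ℝ) * (5 * ℓ)) := by
    refine pow_le_exp (by positivity) ?_ K
    have h4 : (4 : ℝ) ≤ Real.exp (2 * ℓ) := by
      have e1 : (2 : ℝ) ≤ Real.exp 1 := by have := Real.add_one_le_exp (1 : ℝ); norm_num at this; linarith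
      have h2 : Real.exp 2 ≤ Real.exp (2 * ℓ) := Real.exp_le_exp.mpr (by linarith)
      have e2 : Real.exp 2 = Real.exp 1 * Real.exp 1 := by rw [← Real.exp_add]; norm_num
      nlinarith
    calc 4 * (Q.H : ℝ) ^ 3 ≤ Real.exp (2 * ℓ) * Real.exp ℓ ^ 3 := by
          rw [← H_eq_exp (Q := Q)]; exact mul_le_mul_of_nonneg_right h4 (by positivity)
      _ = Real.exp (5 * ℓ) := by rw [← Real.exp_nat_mul, ← Real.exp_add]; ring_nf
  have hx0 : (0 : ℝ) < 7 * ((2 * D.nOf ℓ + K : ℕ) : ℝ) := by push_cast; linarith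
  have f3 : (7 * ((2 * D.nOf ℓ + K : ℕ) : ℝ)) ^ (2 * K) ≤ Real.exp (((2 * K : ℕ) : ℝ) * ℓ ^ dδ D.ε) := by
    refine pow_le_exp hx0.le (le_exp_of_log_le hx0 ?_) _
    exact log_small hL hx0 hnℓ hKℓ (by push_cast; nlinarith)
  obtain ⟨-, d2, -, -, -, d6, d7, d8⟩ := dom hK hCb hℓ (by linarith) hδℓ
  have hfin : ((2 * D.nOf ℓ + K : ℕ) : ℝ) * D.Cb + (K : ℝ) * (5 * ℓ) + ((2 * K : ℕ) : ℝ) * ℓ ^ dδ D.ε ≤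
      10 * D.Cb * K * ℓ := by
    push_cast
    have : (2 * (D.nOf ℓ : ℝ) + K) * D.Cb ≤ 3 * ((K : ℝ) * D.Cb) := by nlinarith
    nlinarith
  unfold TSetup.Amat
  calc D.S.C₀ ^ (2 * D.nOf ℓ + K) * (4 * (Q.H : ℝ) ^ 3) ^ K * (7 * ((2 * D.nOf ℓ + K : ℕ) : ℝ)) ^ (2 * K)
      ≤ Real.exp (((2 * D.nOf ℓ + K : ℕ) : ℝ) * D.Cb + (K : ℝ) * (5 * ℓ) + ((2 * K : ℕ) : ℝ) * ℓ ^ dδ D.ε) :=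
        mul_le_exp (mul_nonneg (pow_nonneg hC00 _) (by positivity)) (mul_le_exp (pow_nonneg hC00 _) f1 f2) f3
    _ ≤ Real.exp (10 * D.Cb * K * ℓ) := Real.exp_le_exp.mpr hfin

/-- `n + 1 ≤ e^{ℓ^δ}`. [folklore] -/
theorem n_succ_le_exp : (D.nOf ℓ : ℝ) + 1 ≤ Real.exp (ℓ ^ dδ D.ε) := by
  obtain ⟨-, -, -, -, hnℓ, -⟩ := params_order hL
  refine le_exp_of_log_le (by positivity) (log_small hL (by positivity) hnℓ hnℓ (by nlinarith [Nat.cast_nonneg (α := ℝ) (D.nOf ℓ)]))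

/-- `Pb(n, k) ≤ e^{14 Cb k ℓ}`. [folklore] -/
theorem Pb_le : D.S.Pb Q (D.nOf ℓ) (D.kOf ℓ) ≤ Real.exp (14 * D.Cb * D.kOf ℓ * ℓ) := by
  obtain ⟨-, hCK, -⟩ := consts_le_Cb (D := D)
  obtain ⟨hnk, -, -, hkℓ, -⟩ := params_order hL
  obtain ⟨-, -, hk1⟩ := k_bounds hL
  have hk : (1 : ℝ) ≤ D.kOf ℓ := by exact_mod_cast hk1
  have hℓ := hL.hℓ
  have hCb := D.one_le_Cb
  obtain ⟨hδ1, hδℓ⟩ := ℓδ_bounds hL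
  have hC : siegelConst D.S.K ≤ Real.exp D.Cb :=
    le_exp_of_log_le (lt_of_lt_of_le one_pos (one_le_siegelConst _)) hCK
  have hsq : ((((D.nOf ℓ) + 1) ^ 2 : ℕ) : ℝ) ≤ Real.exp (2 * ℓ ^ dδ D.ε) := by
    have h := pow_le_exp (by positivity) (n_succ_le_exp hL) 2
    push_cast at h ⊢; simpa using h
  have hA := Amat_le hL hnk hk1 hkℓ
  have hC0 : 0 ≤ siegelConst D.S.K := zero_le_one.trans (one_le_siegelConst _)
  unfold TSetup.Pb
  calc siegelConst D.S.K * (siegelConst D.S.K * ((((D.nOf ℓ) + 1) ^ 2 : ℕ) : ℝ) * D.S.Amat Q (D.nOf ℓ) (D.kOf ℓ))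
      ≤ Real.exp (D.Cb + (D.Cb + 2 * ℓ ^ dδ D.ε + 10 * D.Cb * D.kOf ℓ * ℓ)) :=
        mul_le_exp hC0 hC (mul_le_exp (by positivity) (mul_le_exp hC0 hC hsq) hA)
    _ ≤ Real.exp (14 * D.Cb * D.kOf ℓ * ℓ) := Real.exp_le_exp.mpr (by
        obtain ⟨-, -, d3, -, d5, -⟩ := dom hk hCb hℓ (by linarith) hδℓ
        nlinarith)

/-- `Pc ≤ e^{16 Cb k ℓ}`. [folklore] -/
theorem Pc_le : (D.run Q).Pc ≤ Real.exp (16 * D.Cb * D.kOf ℓ * ℓ) := by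
  obtain ⟨-, -, hk1⟩ := k_bounds hL
  have hk : (1 : ℝ) ≤ D.kOf ℓ := by exact_mod_cast hk1
  have hℓ := hL.hℓ
  have hCb := D.one_le_Cb
  obtain ⟨hδ1, hδℓ⟩ := ℓδ_bounds hL
  have hsq : ((((D.nOf ℓ) + 1) ^ 2 : ℕ) : ℝ) ≤ Real.exp (2 * ℓ ^ dδ D.ε) := by
    have h := pow_le_exp (by positivity) (n_succ_le_exp hL) 2
    push_cast at h ⊢; simpa using h
  change ((((D.nOf ℓ) + 1) ^ 2 : ℕ) : ℝ) * D.S.Pb Q (D.nOf ℓ) (D.kOf ℓ) ≤ _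
  calc _ ≤ Real.exp (2 * ℓ ^ dδ D.ε + 14 * D.Cb * D.kOf ℓ * ℓ) := mul_le_exp (by positivity) hsq (Pb_le hL)
    _ ≤ _ := Real.exp_le_exp.mpr (by
        obtain ⟨-, -, -, -, d5, -⟩ := dom hk hCb hℓ (by linarith) hδℓ
        nlinarith)

omit hL in
/-- `(D.run Q).T = D.T`. [folklore] -/
theorem run_T : (D.run Q).T = D.T := rfl

/-- `D(n, K) ≤ e^{10 Cb K ℓ^δ}` for `n ≤ K ≤ ℓ^{a₁}`, `1 ≤ K`. [folklore] -/
theorem Dcomp_le {K : ℕ} (hnK : D.nOf ℓ ≤ K) (hK1 : 1 ≤ K) (hKℓ : (K : ℝ) ≤ ℓ ^ ea₁ D.ε) :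
    Dcomp D.S D.T (D.nOf ℓ) K ≤ Real.exp (10 * D.Cb * K * ℓ ^ dδ D.ε) := by
  obtain ⟨-, -, -, -, -, -, -, -, -, -, -, hT, -, -, -, hM, -⟩ := consts_le_Cb (D := D)
  obtain ⟨-, -, -, -, hnℓ, -⟩ := params_order hL
  have hK : (1 : ℝ) ≤ K := by exact_mod_cast hK1
  have hnK' : (D.nOf ℓ : ℝ) ≤ K := by exact_mod_cast hnK
  have hCb := D.one_le_Cb
  obtain ⟨hδ1, -⟩ := ℓδ_bounds hL
  have hT1 : 1 ≤ D.T := by unfold T; have := norm_nonneg (D.S.L.ω₂ / D.S.L.ω₁); linarith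
  have hM1 := D.S.G.one_le_M
  have f1 : (K : ℝ) + 1 ≤ Real.exp (ℓ ^ dδ D.ε) :=
    le_exp_of_log_le (by positivity) (log_small hL (by positivity) hnℓ hKℓ (by nlinarith))
  have f2 : (2 : ℝ) ^ K ≤ Real.exp ((K : ℝ) * 1) :=
    pow_le_exp (by norm_num) (by have := Real.add_one_le_exp (1 : ℝ); norm_num at this ⊢; linarith) K
  have f3 : (K : ℝ) ≤ Real.exp (ℓ ^ dδ D.ε) := by linarith [f1]
  have f4 : D.T ^ K ≤ Real.exp ((K : ℝ) * D.Cb) := pow_le_exp (by linarith) (le_exp_of_log_le (by linarith) hT) K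
  have f5 : (7 * ((2 * D.nOf ℓ + K + 1 : ℕ) : ℝ)) ^ (2 * K) ≤ Real.exp (((2 * K : ℕ) : ℝ) * ℓ ^ dδ D.ε) := by
    refine pow_le_exp (by positivity) (le_exp_of_log_le (by positivity) ?_) _
    exact log_small hL (by positivity) hnℓ hKℓ (by push_cast; nlinarith)
  have f6 : D.S.G.M ^ (2 * (D.nOf ℓ + K)) ≤ Real.exp (((2 * (D.nOf ℓ + K) : ℕ) : ℝ) * D.Cb) :=
    pow_le_exp (by linarith) (le_exp_of_log_le (by linarith) hM) _
  unfold Dcomp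
  calc ((K : ℝ) + 1) * 2 ^ K * K * D.T ^ K * (7 * ((2 * D.nOf ℓ + K + 1 : ℕ) : ℝ)) ^ (2 * K) *
        D.S.G.M ^ (2 * (D.nOf ℓ + K))
      ≤ Real.exp (ℓ ^ dδ D.ε + (K : ℝ) * 1 + ℓ ^ dδ D.ε + (K : ℝ) * D.Cb + ((2 * K : ℕ) : ℝ) * ℓ ^ dδ D.ε +
          ((2 * (D.nOf ℓ + K) : ℕ) : ℝ) * D.Cb) :=
        mul_le_exp (by positivity) (mul_le_exp (by positivity) (mul_le_exp (by positivity)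
          (mul_le_exp (by positivity) (mul_le_exp (by positivity) f1 f2) f3) f4) f5) f6
    _ ≤ Real.exp (10 * D.Cb * K * ℓ ^ dδ D.ε) := Real.exp_le_exp.mpr (by
        obtain ⟨-, d2, -, d4, -, d6, d7, -⟩ := dom hK hCb hδ1 (zero_le_one.trans hδ1) le_rfl
        push_cast
        have : (D.nOf ℓ : ℝ) * D.Cb ≤ (K : ℝ) * D.Cb := by nlinarith
        nlinarith)

/-- `Ξ(hh, K+1) ≤ e^{10 (K+1)(hh+1) ℓ^δ}` for `hh, K ≤ ℓ^{a₁}`. [folklore] -/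
theorem xiFactor_le {K hh : ℕ} (hKℓ : (K : ℝ) ≤ ℓ ^ ea₁ D.ε) (hhℓ : (hh : ℝ) ≤ ℓ ^ ea₁ D.ε) :
    xiFactor hh (K + 1) ≤ Real.exp (10 * ((K : ℝ) + 1) * ((hh : ℝ) + 1) * ℓ ^ dδ D.ε) := by
  obtain ⟨hδ1, -⟩ := ℓδ_bounds hL
  have h0 : (0 : ℝ) ≤ ℓ ^ ea₁ D.ε := le_trans (Nat.cast_nonneg _) hKℓ
  have f1 : (hh : ℝ) ≤ Real.exp (ℓ ^ dδ D.ε) := by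
    have : (hh : ℝ) + 1 ≤ Real.exp (ℓ ^ dδ D.ε) :=
      le_exp_of_log_le (by positivity) (log_small hL (by positivity) hhℓ hhℓ (by nlinarith [Nat.cast_nonneg (α := ℝ) hh]))
    linarith
  have f2 : ((K + 1 : ℕ) : ℝ) ≤ Real.exp (ℓ ^ dδ D.ε) := by
    push_cast
    exact le_exp_of_log_le (by positivity) (log_small hL (by positivity) hKℓ hKℓ (by nlinarith [Nat.cast_nonneg (α := ℝ) K]))
  have f3' : 6 * (hh : ℝ) + 7 ≤ Real.exp (ℓ ^ dδ D.ε) :=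
    le_exp_of_log_le (by positivity) (log_small hL (by positivity) hhℓ hhℓ (by nlinarith [Nat.cast_nonneg (α := ℝ) hh]))
  have f3 : (6 * (hh : ℝ) + 7) ^ (K + 1) ≤ Real.exp (((K + 1 : ℕ) : ℝ) * ℓ ^ dδ D.ε) := pow_le_exp (by positivity) f3' _
  have f4 : (3 * (6 * (hh : ℝ) + 7) ^ hh) ^ (2 * (K + 1)) ≤
      Real.exp (((2 * (K + 1) : ℕ) : ℝ) * (2 + (hh : ℝ) * ℓ ^ dδ D.ε)) := by
    refine pow_le_exp (by positivity) ?_ _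
    have h3 : (3 : ℝ) ≤ Real.exp 2 := by nlinarith [Real.add_one_le_exp (2 : ℝ)]
    exact mul_le_exp (by norm_num) h3 (pow_le_exp (by positivity) f3' hh)
  unfold xiFactor
  calc (hh : ℝ) * ((K + 1 : ℕ) : ℝ) * (6 * (hh : ℝ) + 7) ^ (K + 1) * (3 * (6 * (hh : ℝ) + 7) ^ hh) ^ (2 * (K + 1))
      ≤ Real.exp (ℓ ^ dδ D.ε + ℓ ^ dδ D.ε + ((K + 1 : ℕ) : ℝ) * ℓ ^ dδ D.ε +
          ((2 * (K + 1) : ℕ) : ℝ) * (2 + (hh : ℝ) * ℓ ^ dδ D.ε)) :=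
        mul_le_exp (by positivity) (mul_le_exp (by positivity) (mul_le_exp (by positivity) f1 f2) f3) f4
    _ ≤ _ := Real.exp_le_exp.mpr (by
        push_cast
        nlinarith [Nat.cast_nonneg (α := ℝ) hh, Nat.cast_nonneg (α := ℝ) K,
          mul_nonneg (Nat.cast_nonneg (α := ℝ) hh) (Nat.cast_nonneg (α := ℝ) K)])

/-- `η(K, hh) ≤ exp(K + Cb (n+1)(hh+4)² + K Cb + 16 Cb k ℓ + 10 Cb K ℓ^δ - ℓ^{3+ε})` for
`n ≤ K ≤ ℓ^{a₁}`, `1 ≤ K`. [cite: Masser1975, §1.3 (13)] -/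
theorem ηgen_le {K hh : ℕ} (hnK : D.nOf ℓ ≤ K) (hK1 : 1 ≤ K) (hKℓ : (K : ℝ) ≤ ℓ ^ ea₁ D.ε) :
    (D.run Q).ηgen K hh ≤ Real.exp ((K : ℝ) + D.Cb * ((D.nOf ℓ : ℝ) + 1) * ((hh : ℝ) + 4) ^ 2 +
      (K : ℝ) * D.Cb + 16 * D.Cb * D.kOf ℓ * ℓ + 10 * D.Cb * K * ℓ ^ dδ D.ε - ℓ ^ eE D.ε) := by
  obtain ⟨-, -, -, -, -, -, hCu, -, -, -, -, -, hT₁, -⟩ := consts_le_Cb (D := D)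
  have hCb := D.one_le_Cb
  have hT1 : 1 ≤ D.T := by unfold T; have := norm_nonneg (D.S.L.ω₂ / D.S.L.ω₁); linarith
  have f1 : (2 : ℝ) ^ K ≤ Real.exp ((K : ℝ) * 1) :=
    pow_le_exp (by norm_num) (by have := Real.add_one_le_exp (1 : ℝ); norm_num at this ⊢; linarith) K
  have f2 : Real.exp (D.K.Cu * ((D.nOf ℓ : ℝ) + 1) * (1 + ((hh : ℝ) + 3) ^ 2)) ≤
      Real.exp (D.Cb * ((D.nOf ℓ : ℝ) + 1) * ((hh : ℝ) + 4) ^ 2) := by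
    refine Real.exp_le_exp.mpr ?_
    have h1 : (1 + ((hh : ℝ) + 3) ^ 2) ≤ ((hh : ℝ) + 4) ^ 2 := by nlinarith [Nat.cast_nonneg (α := ℝ) hh]
    have h2 : 0 ≤ D.K.Cu * ((D.nOf ℓ : ℝ) + 1) := mul_nonneg D.K.hCu0 (by positivity)
    calc D.K.Cu * ((D.nOf ℓ : ℝ) + 1) * (1 + ((hh : ℝ) + 3) ^ 2)
        ≤ D.K.Cu * ((D.nOf ℓ : ℝ) + 1) * ((hh : ℝ) + 4) ^ 2 := mul_le_mul_of_nonneg_left h1 h2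
      _ ≤ D.Cb * ((D.nOf ℓ : ℝ) + 1) * ((hh : ℝ) + 4) ^ 2 := by gcongr
  have f3 : (D.run Q).T₁ ^ K ≤ Real.exp ((K : ℝ) * D.Cb) :=
    pow_le_exp (zero_le_one.trans (le_max_left _ _)) (le_exp_of_log_le (lt_of_lt_of_le one_pos (le_max_left _ _)) hT₁) K
  have f4 := Pc_le hL
  have f5 := Dcomp_le hL hnK hK1 hKℓ
  have f6 : (D.run Q).E ≤ Real.exp (-ℓ ^ eE D.ε) := le_of_eq (run_E (D := D))
  have hD0 : 0 ≤ Dcomp D.S D.T (D.nOf ℓ) K := Dcomp_nonneg D.S (by linarith) _ _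
  have hPc0 : 0 ≤ (D.run Q).Pc := (D.run Q).Pc_nonneg
  change (2 : ℝ) ^ K * Real.exp (D.K.Cu * ((D.nOf ℓ : ℝ) + 1) * (1 + ((hh : ℝ) + 3) ^ 2)) *
    ((D.run Q).T₁ ^ K * ((D.run Q).Pc * Dcomp D.S D.T (D.nOf ℓ) K * (D.run Q).E)) ≤ _
  calc _ ≤ Real.exp ((K : ℝ) * 1 + D.Cb * ((D.nOf ℓ : ℝ) + 1) * ((hh : ℝ) + 4) ^ 2 +
        ((K : ℝ) * D.Cb + (16 * D.Cb * D.kOf ℓ * ℓ + 10 * D.Cb * K * ℓ ^ dδ D.ε + -ℓ ^ eE D.ε))) :=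
        mul_le_exp (by positivity) (mul_le_exp (by positivity) f1 f2)
          (mul_le_exp (pow_nonneg (zero_le_one.trans (le_max_left _ _)) _) f3
            (mul_le_exp (mul_nonneg hPc0 hD0) (mul_le_exp hPc0 f4 f5) f6))
    _ = _ := by ring_nf

/-- `Θ(hh) ≤ exp(16 Cb k ℓ + 26 Cb (n+1)(hh+1)²)`. [cite: Masser1975, Lemma 1.9] -/
theorem Θgen_le (hh : ℕ) : (D.run Q).Θgen hh ≤
    Real.exp (16 * D.Cb * D.kOf ℓ * ℓ + 26 * D.Cb * ((D.nOf ℓ : ℝ) + 1) * ((hh : ℝ) + 1) ^ 2) := by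
  obtain ⟨-, -, -, hCG, -⟩ := consts_le_Cb (D := D)
  have hPc0 : 0 ≤ (D.run Q).Pc := (D.run Q).Pc_nonneg
  have f2 : Real.exp (D.K.CG * ((D.nOf ℓ : ℝ) + 1) * (1 + (5 * ((hh : ℝ) + 1)) ^ 2)) ≤
      Real.exp (26 * D.Cb * ((D.nOf ℓ : ℝ) + 1) * ((hh : ℝ) + 1) ^ 2) := by
    refine Real.exp_le_exp.mpr ?_
    have h1 : (1 + (5 * ((hh : ℝ) + 1)) ^ 2) ≤ 26 * ((hh : ℝ) + 1) ^ 2 := by nlinarith [Nat.cast_nonneg (α := ℝ) hh]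
    have h2 : 0 ≤ D.K.CG * ((D.nOf ℓ : ℝ) + 1) := mul_nonneg D.K.hCG0 (by positivity)
    calc D.K.CG * ((D.nOf ℓ : ℝ) + 1) * (1 + (5 * ((hh : ℝ) + 1)) ^ 2)
        ≤ D.K.CG * ((D.nOf ℓ : ℝ) + 1) * (26 * ((hh : ℝ) + 1) ^ 2) := mul_le_mul_of_nonneg_left h1 h2
      _ ≤ D.Cb * ((D.nOf ℓ : ℝ) + 1) * (26 * ((hh : ℝ) + 1) ^ 2) := by gcongr
      _ = _ := by ring
  change (D.run Q).Pc * Real.exp (D.K.CG * ((D.nOf ℓ : ℝ) + 1) * (1 + (5 * ((hh : ℝ) + 1)) ^ 2)) ≤ _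
  exact mul_le_exp hPc0 (Pc_le hL) f2

omit hL in
/-- `(5/6)^N = e^{-N log(6/5)}`. [folklore] -/
theorem five_sixths_pow (N : ℕ) : (5 / 6 : ℝ) ^ N = Real.exp (-((N : ℝ) * Real.log (6 / 5))) := by
  rw [show -((N : ℝ) * Real.log (6 / 5)) = N * (-Real.log (6 / 5)) by ring, Real.exp_nat_mul,
    Real.exp_neg, Real.exp_log (by norm_num)]
  norm_num

omit hL in
/-- `1/6 ≤ log(6/5) ≤ 1/5`. [folklore] -/
theorem log_six_fifths : 1 / 6 ≤ Real.log (6 / 5) ∧ Real.log (6 / 5) ≤ 1 / 5 := by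
  constructor
  · have := Real.one_sub_inv_le_log_of_pos (by norm_num : (0 : ℝ) < 6 / 5); norm_num at this ⊢; linarith
  · have := Real.log_le_sub_one_of_pos (by norm_num : (0 : ℝ) < 6 / 5); norm_num at this ⊢; linarith

omit hL in
/-- `0 ≤ η` for the run. [folklore] -/
theorem ηgen_nonneg' (K hh : ℕ) : 0 ≤ (D.run Q).ηgen K hh := by
  have hT1 : 1 ≤ D.T := by unfold T; have := norm_nonneg (D.S.L.ω₂ / D.S.L.ω₁); linarith
  have hD0 : 0 ≤ Dcomp D.S D.T (D.run Q).n K := Dcomp_nonneg D.S (by linarith) _ _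
  have hPc0 : 0 ≤ (D.run Q).Pc := (D.run Q).Pc_nonneg
  have hE0 : 0 ≤ (D.run Q).E := Real.exp_nonneg _
  have hT₁ : 0 ≤ (D.run Q).T₁ ^ K := pow_nonneg (zero_le_one.trans (le_max_left _ _)) _
  change 0 ≤ (2 : ℝ) ^ K * Real.exp _ * ((D.run Q).T₁ ^ K * ((D.run Q).Pc * Dcomp D.S D.T (D.run Q).n K * (D.run Q).E))
  positivity

omit hL in
/-- **The extrapolation gain**: if `η Ξ ≤ e^{-X}` and `Θ ≤ e^{X/2}` with `X = (K+1) hh log(6/5)`,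
then `Ggen(K, hh) ≤ 3 e^{-X/2}`. [cite: Masser1975, §1.3 (proof of Lemma 1.10)] -/
theorem Ggen_le_of {K hh : ℕ} {Lη LΞ LΘ : ℝ} (hη : (D.run Q).ηgen K hh ≤ Real.exp Lη)
    (hΞ : xiFactor hh (K + 1) ≤ Real.exp LΞ) (hΘ : (D.run Q).Θgen hh ≤ Real.exp LΘ)
    (h1 : Lη + LΞ ≤ -((((K + 1) * hh : ℕ) : ℝ) * Real.log (6 / 5)))
    (h2 : LΘ ≤ (((K + 1) * hh : ℕ) : ℝ) * Real.log (6 / 5) / 2) :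
    (D.run Q).Ggen K hh ≤ 3 * Real.exp (-((((K + 1) * hh : ℕ) : ℝ) * Real.log (6 / 5) / 2)) := by
  set X : ℝ := (((K + 1) * hh : ℕ) : ℝ) * Real.log (6 / 5) with hX
  have hX0 : 0 ≤ X := mul_nonneg (Nat.cast_nonneg _) (by linarith [log_six_fifths.1])
  have hηΞ : (D.run Q).ηgen K hh * xiFactor hh (K + 1) ≤ Real.exp (-X) :=
    (mul_le_exp (ηgen_nonneg' K hh) hη hΞ).trans (Real.exp_le_exp.mpr h1)
  have hΘ' : (D.run Q).Θgen hh ≤ Real.exp (X / 2) := hΘ.trans (Real.exp_le_exp.mpr h2)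
  have h56 : (5 / 6 : ℝ) ^ ((K + 1) * hh) = Real.exp (-X) := five_sixths_pow _
  unfold Run.Ggen
  rw [h56]
  have e1 : Real.exp (-X) ≤ Real.exp (-(X / 2)) := Real.exp_le_exp.mpr (by linarith)
  have e2 : Real.exp (X / 2) * Real.exp (-X) = Real.exp (-(X / 2)) := by rw [← Real.exp_add]; ring_nf
  have e3 : Real.exp (-X) * Real.exp (-X) ≤ Real.exp (-(X / 2)) := by
    rw [← Real.exp_add]; exact Real.exp_le_exp.mpr (by linarith)
  have hpos := Real.exp_pos (-X)
  calc (D.run Q).ηgen K hh * xiFactor hh (K + 1) +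
        ((D.run Q).Θgen hh + (D.run Q).ηgen K hh * xiFactor hh (K + 1)) * Real.exp (-X)
      ≤ Real.exp (-X) + (Real.exp (X / 2) + Real.exp (-X)) * Real.exp (-X) := by
        gcongr
    _ = Real.exp (-X) + Real.exp (X / 2) * Real.exp (-X) + Real.exp (-X) * Real.exp (-X) := by ring
    _ ≤ Real.exp (-(X / 2)) + Real.exp (-(X / 2)) + Real.exp (-(X / 2)) := by rw [e2]; gcongr
    _ = 3 * Real.exp (-(X / 2)) := by ring
    _ = _ := by rw [hX]

/-- rpow products at `ℓ`. [folklore] -/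
theorem rpow_add' (u v : ℝ) : ℓ ^ (u + v) = ℓ ^ u * ℓ ^ v := Real.rpow_add (ℓ_pos hL) u v

/-- Auxiliary (`rpow_two'`). [folklore] -/
theorem rpow_two' (u : ℝ) : ℓ ^ (2 * u) = ℓ ^ u * ℓ ^ u := by
  rw [two_mul, rpow_add' hL]

/-- **One extrapolation step, numerically**: for parameters `K = [ℓ^{a_K}]`, `hh = [ℓ^{g_h}]`
and under the largeness inequalities, `Ggen(K, hh) ≤ 3 e^{-ℓ^{a_K + g_h}/24}`.
[cite: Masser1975, §1.3 (proofs of Lemmas 1.10 and 1.11)] -/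
theorem Ggen_le_three {aK gh : ℝ} (h2K : 2 ≤ ℓ ^ aK) (h2h : 2 ≤ ℓ ^ gh)
    (hnK : D.nOf ℓ ≤ ⌊ℓ ^ aK⌋₊) (haK : ea D.ε ≤ aK) (haK₁ : aK ≤ ea₁ D.ε) (hgh : gh ≤ ea₁ D.ε)
    (i1 : 350 * D.Cb * ℓ ^ (aK + gh + dδ D.ε) ≤ ℓ ^ eE D.ε)
    (i4 : 350 * D.Cb * ℓ ^ (aK + dδ D.ε) ≤ ℓ ^ eE D.ε)
    (j1 : 3000 * D.Cb ^ 2 * ℓ ^ (ea D.ε + 1) ≤ ℓ ^ (aK + gh))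
    (j2 : 40000 * D.Cb * ℓ ^ (eb D.ε + 2 * gh) ≤ ℓ ^ (aK + gh)) :
    (D.run Q).Ggen ⌊ℓ ^ aK⌋₊ ⌊ℓ ^ gh⌋₊ ≤ 3 * Real.exp (-(ℓ ^ aK * ℓ ^ gh / 24)) := by
  -- names
  set K := ⌊ℓ ^ aK⌋₊ with hKdef
  set hh := ⌊ℓ ^ gh⌋₊ with hhdef
  have hℓ := hL.hℓ
  have hℓ0 := ℓ_pos hL
  have hCb := D.one_le_Cb
  obtain ⟨hδ1, hδℓ⟩ := ℓδ_bounds hL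
  have i3 := hL.hE3
  -- parameter facts
  obtain ⟨hKle, hKge⟩ : (K : ℝ) ≤ ℓ ^ aK ∧ ℓ ^ aK / 2 ≤ K := ⟨(floor_sandwich h2K).2, (floor_sandwich h2K).1⟩
  have hK1 : ℓ ^ aK ≤ (K : ℝ) + 1 := (Nat.lt_floor_add_one _).le
  obtain ⟨hhle, hhge⟩ : (hh : ℝ) ≤ ℓ ^ gh ∧ ℓ ^ gh / 2 ≤ hh := ⟨(floor_sandwich h2h).2, (floor_sandwich h2h).1⟩
  have hh1 : (1 : ℝ) ≤ hh := by linarith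
  have hK1' : (1 : ℝ) ≤ K := by linarith
  have hK1n : 1 ≤ K := by exact_mod_cast hK1'
  obtain ⟨hnle, -, -⟩ := n_bounds hL
  obtain ⟨hkle, -, -⟩ := k_bounds hL
  have hAA' : ℓ ^ ea D.ε ≤ ℓ ^ aK := rpow_mono hL haK
  have hA'A₁ : ℓ ^ aK ≤ ℓ ^ ea₁ D.ε := rpow_mono hL haK₁
  have hKℓ : (K : ℝ) ≤ ℓ ^ ea₁ D.ε := hKle.trans hA'A₁
  have hhℓ : (hh : ℝ) ≤ ℓ ^ ea₁ D.ε := hhle.trans (rpow_mono hL hgh)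
  have hb1 : 1 ≤ ℓ ^ eb D.ε := one_le_rpow' hL (D.exps).2.2.2.2.2.2.2.2.le
  -- rewrite the rpow inequalities as products
  rw [rpow_add' hL, rpow_add' hL] at i1
  rw [rpow_add' hL, rpow_two' hL, rpow_add' hL] at j2
  rw [rpow_add' hL] at i4
  rw [rpow_add' hL, Real.rpow_one, rpow_add' hL] at j1
  rw [rpow_add' hL, Real.rpow_one] at i3
  have hA'0 : 0 ≤ (ℓ ^ aK) := by positivity
  have hG'0 : 0 ≤ (ℓ ^ gh) := by positivity
  -- the three exp bounds
  have hη := ηgen_le hL (hh := hh) hnK hK1n hKℓ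
  have hΞ := xiFactor_le hL hKℓ hhℓ
  have hΘ := Θgen_le hL hh
  have hl65 := log_six_fifths
  -- product facts
  have P1 : ((D.nOf ℓ : ℝ) + 1) * ((hh : ℝ) + 4) ^ 2 ≤ 50 * ((ℓ ^ eb D.ε) * (ℓ ^ gh) * (ℓ ^ gh)) := by
    have e1 : (D.nOf ℓ : ℝ) + 1 ≤ 2 * (ℓ ^ eb D.ε) := by linarith
    have e2 : ((hh : ℝ) + 4) ^ 2 ≤ (5 * (ℓ ^ gh)) ^ 2 := by
      apply pow_le_pow_left₀ (by positivity); linarith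
    calc ((D.nOf ℓ : ℝ) + 1) * ((hh : ℝ) + 4) ^ 2 ≤ 2 * (ℓ ^ eb D.ε) * (5 * (ℓ ^ gh)) ^ 2 :=
          mul_le_mul e1 e2 (by positivity) (by positivity)
      _ = 50 * ((ℓ ^ eb D.ε) * (ℓ ^ gh) * (ℓ ^ gh)) := by ring
  have P2 : (K : ℝ) ≤ (ℓ ^ aK) * (ℓ ^ dδ D.ε) := hKle.trans (le_mul_of_one_le_right hA'0 hδ1)
  have P4 : (D.kOf ℓ : ℝ) * ℓ ≤ (ℓ ^ ea₁ D.ε) * ℓ := mul_le_mul_of_nonneg_right (hkle.trans (hAA'.trans hA'A₁)) hℓ0.le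
  have P5 : (K : ℝ) * (ℓ ^ dδ D.ε) ≤ (ℓ ^ aK) * (ℓ ^ dδ D.ε) := mul_le_mul_of_nonneg_right hKle (by positivity)
  have P6 : ((K : ℝ) + 1) * ((hh : ℝ) + 1) * (ℓ ^ dδ D.ε) ≤ 4 * ((ℓ ^ aK) * (ℓ ^ gh) * (ℓ ^ dδ D.ε)) := by
    have e1 : (K : ℝ) + 1 ≤ 2 * (ℓ ^ aK) := by linarith
    have e2 : (hh : ℝ) + 1 ≤ 2 * (ℓ ^ gh) := by linarith
    have := mul_le_mul e1 e2 (by positivity) (by positivity)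
    calc ((K : ℝ) + 1) * ((hh : ℝ) + 1) * (ℓ ^ dδ D.ε) ≤ 2 * (ℓ ^ aK) * (2 * (ℓ ^ gh)) * (ℓ ^ dδ D.ε) := mul_le_mul_of_nonneg_right this (by positivity)
      _ = 4 * ((ℓ ^ aK) * (ℓ ^ gh) * (ℓ ^ dδ D.ε)) := by ring
  have P7 : (((K + 1) * hh : ℕ) : ℝ) * Real.log (6 / 5) ≤ (ℓ ^ aK) * (ℓ ^ gh) * (ℓ ^ dδ D.ε) := by
    have e1 : (((K + 1) * hh : ℕ) : ℝ) ≤ 2 * (ℓ ^ aK) * (ℓ ^ gh) := by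
      push_cast
      exact mul_le_mul (by linarith) hhle (by positivity) (by positivity)
    have e2 : (ℓ ^ aK) * (ℓ ^ gh) ≤ (ℓ ^ aK) * (ℓ ^ gh) * (ℓ ^ dδ D.ε) := le_mul_of_one_le_right (by positivity) hδ1
    have e3 : 0 ≤ (ℓ ^ aK) * (ℓ ^ gh) := by positivity
    calc (((K + 1) * hh : ℕ) : ℝ) * Real.log (6 / 5) ≤ 2 * (ℓ ^ aK) * (ℓ ^ gh) * (1 / 5) :=
          mul_le_mul e1 hl65.2 (by linarith [hl65.1]) (by positivity)
      _ ≤ (ℓ ^ aK) * (ℓ ^ gh) * (ℓ ^ dδ D.ε) := by linarith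
  have P8 : (ℓ ^ aK) * (ℓ ^ dδ D.ε) ≤ D.Cb * ((ℓ ^ aK) * (ℓ ^ dδ D.ε)) := le_mul_of_one_le_left (by positivity) hCb
  have P9 : (ℓ ^ aK) * (ℓ ^ gh) * (ℓ ^ dδ D.ε) ≤ D.Cb * ((ℓ ^ aK) * (ℓ ^ gh) * (ℓ ^ dδ D.ε)) := le_mul_of_one_le_left (by positivity) hCb
  have P10 : (ℓ ^ eb D.ε) * (ℓ ^ gh) * (ℓ ^ gh) ≤ D.Cb * ((ℓ ^ eb D.ε) * (ℓ ^ gh) * (ℓ ^ gh)) := le_mul_of_one_le_left (by positivity) hCb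
  have hCb0 : 0 ≤ D.Cb := zero_le_one.trans hCb
  have P11 : D.Cb * ((ℓ ^ ea₁ D.ε) * ℓ) ≤ D.Cb ^ 2 * ((ℓ ^ ea₁ D.ε) * ℓ) :=
    mul_le_mul_of_nonneg_right (le_self_pow₀ hCb two_ne_zero) (by positivity)
  have P3 : (K : ℝ) * D.Cb ≤ D.Cb * ((ℓ ^ aK) * (ℓ ^ dδ D.ε)) := by
    have := mul_le_mul_of_nonneg_left P2 hCb0; linarith
  have P12 : D.Cb * ((D.nOf ℓ : ℝ) + 1) * ((hh : ℝ) + 4) ^ 2 ≤ 50 * (D.Cb * ((ℓ ^ eb D.ε) * (ℓ ^ gh) * (ℓ ^ gh))) := by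
    have := mul_le_mul_of_nonneg_left P1 hCb0; linarith
  have P13 : D.Cb * (D.kOf ℓ : ℝ) * ℓ ≤ D.Cb * ((ℓ ^ ea₁ D.ε) * ℓ) := by
    have := mul_le_mul_of_nonneg_left P4 hCb0; linarith
  have P14 : D.Cb * (K : ℝ) * (ℓ ^ dδ D.ε) ≤ D.Cb * ((ℓ ^ aK) * (ℓ ^ dδ D.ε)) := by
    have := mul_le_mul_of_nonneg_left P5 hCb0; linarith
  -- lower bound for X
  have Q1 : (ℓ ^ aK) * (ℓ ^ gh) / 12 ≤ (((K + 1) * hh : ℕ) : ℝ) * Real.log (6 / 5) := by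
    have e1 : (ℓ ^ aK) * ((ℓ ^ gh) / 2) ≤ (((K + 1) * hh : ℕ) : ℝ) := by
      push_cast; exact mul_le_mul hK1 hhge (by positivity) (by positivity)
    calc (ℓ ^ aK) * (ℓ ^ gh) / 12 = (ℓ ^ aK) * ((ℓ ^ gh) / 2) * (1 / 6) := by ring
      _ ≤ (((K + 1) * hh : ℕ) : ℝ) * Real.log (6 / 5) := mul_le_mul e1 hl65.1 (by norm_num) (by positivity)
  have Q3 : ((D.nOf ℓ : ℝ) + 1) * ((hh : ℝ) + 1) ^ 2 ≤ 8 * ((ℓ ^ eb D.ε) * (ℓ ^ gh) * (ℓ ^ gh)) := by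
    have e1 : (D.nOf ℓ : ℝ) + 1 ≤ 2 * (ℓ ^ eb D.ε) := by linarith
    have e2 : ((hh : ℝ) + 1) ^ 2 ≤ (2 * (ℓ ^ gh)) ^ 2 := by
      apply pow_le_pow_left₀ (by positivity); linarith
    calc ((D.nOf ℓ : ℝ) + 1) * ((hh : ℝ) + 1) ^ 2 ≤ 2 * (ℓ ^ eb D.ε) * (2 * (ℓ ^ gh)) ^ 2 :=
          mul_le_mul e1 e2 (by positivity) (by positivity)
      _ = 8 * ((ℓ ^ eb D.ε) * (ℓ ^ gh) * (ℓ ^ gh)) := by ring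
  have Q4 : D.Cb * ((D.nOf ℓ : ℝ) + 1) * ((hh : ℝ) + 1) ^ 2 ≤ 8 * (D.Cb * ((ℓ ^ eb D.ε) * (ℓ ^ gh) * (ℓ ^ gh))) := by
    have := mul_le_mul_of_nonneg_left Q3 hCb0; linarith
  -- assemble
  have t1 : 350 * (K : ℝ) ≤ ℓ ^ eE D.ε := by linarith
  have t2 : 350 * (D.Cb * ((D.nOf ℓ : ℝ) + 1) * ((hh : ℝ) + 4) ^ 2) ≤ 50 * ℓ ^ eE D.ε := by
    -- `50 Cb Bb G'² ≤ (50/40000) A' G' ≤ A' G' Dd ≤ E'/350`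
    have e2 : ℓ ^ aK * ℓ ^ gh ≤ ℓ ^ aK * ℓ ^ gh * ℓ ^ dδ D.ε := le_mul_of_one_le_right (by positivity) hδ1
    linarith
  have t3 : 350 * ((K : ℝ) * D.Cb) ≤ ℓ ^ eE D.ε := by linarith
  have t4 : 350 * (16 * D.Cb * D.kOf ℓ * ℓ) ≤ 16 * ℓ ^ eE D.ε := by linarith
  have t5 : 350 * (10 * D.Cb * K * (ℓ ^ dδ D.ε)) ≤ 10 * ℓ ^ eE D.ε := by linarith
  have t6 : 350 * (10 * ((K : ℝ) + 1) * ((hh : ℝ) + 1) * (ℓ ^ dδ D.ε)) ≤ 40 * ℓ ^ eE D.ε := by linarith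
  have t7 : 350 * ((((K + 1) * hh : ℕ) : ℝ) * Real.log (6 / 5)) ≤ ℓ ^ eE D.ε := by linarith
  have t8 : 0 ≤ ℓ ^ eE D.ε := by positivity
  have hsum : 350 * ((K : ℝ) + D.Cb * ((D.nOf ℓ : ℝ) + 1) * ((hh : ℝ) + 4) ^ 2 + (K : ℝ) * D.Cb +
      16 * D.Cb * D.kOf ℓ * ℓ + 10 * D.Cb * K * (ℓ ^ dδ D.ε) + 10 * ((K : ℝ) + 1) * ((hh : ℝ) + 1) * (ℓ ^ dδ D.ε) +
      (((K + 1) * hh : ℕ) : ℝ) * Real.log (6 / 5)) ≤ 119 * ℓ ^ eE D.ε := by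
    linarith [t1, t2, t3, t4, t5, t6, t7]
  have s1 : (K : ℝ) + D.Cb * ((D.nOf ℓ : ℝ) + 1) * ((hh : ℝ) + 4) ^ 2 + (K : ℝ) * D.Cb +
      16 * D.Cb * D.kOf ℓ * ℓ + 10 * D.Cb * K * (ℓ ^ dδ D.ε) - (ℓ ^ eE D.ε) + 10 * ((K : ℝ) + 1) * ((hh : ℝ) + 1) * (ℓ ^ dδ D.ε) ≤
      -((((K + 1) * hh : ℕ) : ℝ) * Real.log (6 / 5)) := by
    linarith [hsum, t8]
  have R1 : D.Cb * (D.kOf ℓ : ℝ) * ℓ ≤ D.Cb * ((ℓ ^ ea D.ε) * ℓ) := by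
    have := mul_le_mul_of_nonneg_left (mul_le_mul_of_nonneg_right hkle hℓ0.le) hCb0; linarith
  have R2 : D.Cb * ((ℓ ^ ea D.ε) * ℓ) ≤ D.Cb ^ 2 * ((ℓ ^ ea D.ε) * ℓ) :=
    mul_le_mul_of_nonneg_right (le_self_pow₀ hCb two_ne_zero) (by positivity)
  have s2 : 16 * D.Cb * D.kOf ℓ * ℓ + 26 * D.Cb * ((D.nOf ℓ : ℝ) + 1) * ((hh : ℝ) + 1) ^ 2 ≤
      (((K + 1) * hh : ℕ) : ℝ) * Real.log (6 / 5) / 2 := by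
    have hAG0 : 0 ≤ ℓ ^ aK * ℓ ^ gh := by positivity
    have u1 : 16 * D.Cb * D.kOf ℓ * ℓ ≤ (16 / 3000) * (ℓ ^ aK * ℓ ^ gh) := by linarith only [R1, R2, j1]
    have u2 : 26 * D.Cb * ((D.nOf ℓ : ℝ) + 1) * ((hh : ℝ) + 1) ^ 2 ≤ (208 / 40000) * (ℓ ^ aK * ℓ ^ gh) :=
      calc 26 * D.Cb * ((D.nOf ℓ : ℝ) + 1) * ((hh : ℝ) + 1) ^ 2
          = 26 * (D.Cb * ((D.nOf ℓ : ℝ) + 1) * ((hh : ℝ) + 1) ^ 2) := by ring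
        _ ≤ 26 * (8 * (D.Cb * ((ℓ ^ eb D.ε) * (ℓ ^ gh) * (ℓ ^ gh)))) := by linarith only [Q4]
        _ = (208 / 40000) * (40000 * D.Cb * (ℓ ^ eb D.ε * (ℓ ^ gh * ℓ ^ gh))) := by ring
        _ ≤ (208 / 40000) * (ℓ ^ aK * ℓ ^ gh) := by linarith only [j2]
    have u3 : ℓ ^ aK * ℓ ^ gh / 24 ≤ (((K + 1) * hh : ℕ) : ℝ) * Real.log (6 / 5) / 2 := by
      linarith only [Q1]
    linarith only [u1, u2, u3, hAG0]
  have hG := Ggen_le_of (D := D) (Q := Q) hη hΞ hΘ s1 s2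
  refine hG.trans ?_
  refine mul_le_mul_of_nonneg_left (Real.exp_le_exp.mpr ?_) (by norm_num)
  linarith

/-! #### The easy fields of `Run.Hyp` -/

omit hL in
/-- Auxiliary (`run_n`). [folklore] -/
theorem run_n : (D.run Q).n = D.nOf ℓ := rfl
omit hL in
/-- Auxiliary (`run_k`). [folklore] -/
theorem run_k : (D.run Q).k = D.kOf ℓ := rfl
omit hL in
/-- Auxiliary (`run_h`). [folklore] -/
theorem run_h : (D.run Q).h = D.hOf ℓ := rfl
omit hL in
/-- Auxiliary (`run_k₁`). [folklore] -/
theorem run_k₁ : (D.run Q).k₁ = D.k₁Of ℓ := rfl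
omit hL in
/-- Auxiliary (`run_h₁`). [folklore] -/
theorem run_h₁ : (D.run Q).h₁ = D.h₁Of ℓ := rfl

/-- `4(k+1) ≤ (n+1)²`. [cite: Masser1975, §1.3 (Lemma 1.8: "2L² unknowns, (k+1)L+… equations")] -/
theorem hyp_siegel : 4 * ((D.run Q).k + 1) ≤ ((D.run Q).n + 1) ^ 2 := by
  rw [run_n, run_k]
  obtain ⟨hkle, -, -⟩ := k_bounds hL
  obtain ⟨-, hnge, -⟩ := n_bounds hL
  have hS1 := hL.hS1
  rw [rpow_two' hL] at hS1
  have h2a := hL.h2a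
  have hb0 : 0 ≤ ℓ ^ eb D.ε := by positivity
  have hreal : (4 : ℝ) * ((D.kOf ℓ : ℝ) + 1) ≤ ((D.nOf ℓ : ℝ) + 1) ^ 2 := by
    have h1 : ℓ ^ eb D.ε / 2 ≤ (D.nOf ℓ : ℝ) + 1 := by linarith
    have h2 : (ℓ ^ eb D.ε / 2) ^ 2 ≤ ((D.nOf ℓ : ℝ) + 1) ^ 2 := pow_le_pow_left₀ (by positivity) h1 2
    nlinarith
  exact_mod_cast hreal

/-- `R n ≤ h₁ + 1`. [cite: Masser1975, §1.3 (Lemma 1.11)] -/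
theorem hyp_P1 : (D.run Q).K.R * (D.run Q).n ≤ ((D.run Q).h₁ : ℝ) + 1 := by
  rw [run_n, run_h₁]
  change D.K.R * (D.nOf ℓ : ℝ) ≤ (D.h₁Of ℓ : ℝ) + 1
  obtain ⟨-, -, -, -, -, -, -, -, -, hR, -⟩ := consts_le_Cb (D := D)
  obtain ⟨hnle, -, -⟩ := n_bounds hL
  obtain ⟨-, hh₁ge, -⟩ := h₁_bounds hL
  have hS2 := hL.hS2
  have hR0 := D.K.hR.le
  have : D.K.R * (D.nOf ℓ : ℝ) ≤ D.Cb * ℓ ^ eb D.ε := mul_le_mul hR hnle (Nat.cast_nonneg _) (zero_le_one.trans D.one_le_Cb)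
  linarith

/-- `C₁₀ n < H`. [cite: Masser1975, §1.3 (end: "max(|A|,|B|,|C|) < c₂₈L < H")] -/
theorem hyp_P3 : (((D.run Q).K.C₁₀ * (D.run Q).n : ℕ) : ℤ) < (D.run Q).Q.H := by
  rw [run_n]
  change ((D.K.C₁₀ * D.nOf ℓ : ℕ) : ℤ) < Q.H
  obtain ⟨-, -, -, -, -, -, -, hC, -⟩ := consts_le_Cb (D := D)
  obtain ⟨hnle, -, -⟩ := n_bounds hL
  have hreal : ((D.K.C₁₀ * D.nOf ℓ : ℕ) : ℝ) < Q.H := by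
    push_cast
    calc (D.K.C₁₀ : ℝ) * D.nOf ℓ ≤ D.Cb * ℓ ^ eb D.ε :=
          mul_le_mul hC hnle (Nat.cast_nonneg _) (zero_le_one.trans D.one_le_Cb)
      _ < Real.exp ℓ := hL.hexp
      _ = Q.H := (H_eq_exp (Q := Q)).symm
  exact_mod_cast hreal

omit hL in
/-- `1 ≤ Bc`. [folklore] -/
theorem hyp_Bc : 1 ≤ (D.run Q).Bc := by
  change (1 : ℝ) ≤ ((((D.run Q).n + 1) ^ 2 : ℕ) : ℝ) * D.S.Pb Q (D.run Q).n (D.run Q).k *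
    D.S.Amat Q (D.run Q).n (D.run Q).k₁
  have hq : (1 : ℝ) ≤ ((((D.run Q).n + 1) ^ 2 : ℕ) : ℝ) := by exact_mod_cast Nat.one_le_pow _ _ (by omega)
  exact one_le_mul_of_one_le_of_one_le (one_le_mul_of_one_le_of_one_le hq (D.S.one_le_Pb Q _ _))
    (D.S.one_le_Amat Q _ _)

omit hL in
/-- `2 ≤ e`, `4 < e²`, `18 ≤ e³`, `54 ≤ e⁵`. [folklore] -/
theorem exp_consts : (2 : ℝ) ≤ Real.exp 1 ∧ 4 < Real.exp 2 ∧ 18 ≤ Real.exp 3 ∧ 54 ≤ Real.exp 5 := by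
  have e1 := Real.exp_one_gt_d9
  have h2 : Real.exp 2 = Real.exp 1 * Real.exp 1 := by rw [← Real.exp_add]; norm_num
  have h3 : Real.exp 3 = Real.exp 2 * Real.exp 1 := by rw [← Real.exp_add]; norm_num
  have h5 : Real.exp 5 = Real.exp 2 * Real.exp 3 := by rw [← Real.exp_add]; norm_num
  have he0 : 0 < Real.exp 1 := Real.exp_pos 1
  have h2v : 7.38 < Real.exp 2 := by rw [h2]; nlinarith
  have h3v : 20 < Real.exp 3 := by rw [h3]; nlinarith
  have h5v : 54 ≤ Real.exp 5 := by rw [h5]; nlinarith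
  exact ⟨by linarith, by linarith, by linarith, h5v⟩

/-- `3 C₁₀ n T E ≤ (18 C₁₀ n H⁴)⁻¹`. [cite: Masser1975, §1.3 (end, footnote (†))] -/
theorem hyp_P4 : 3 * ((D.run Q).K.C₁₀ : ℝ) * (D.run Q).n * (D.run Q).T * (D.run Q).E ≤
    (18 * ((D.run Q).K.C₁₀ : ℝ) * (D.run Q).n * ((D.run Q).Q.H : ℝ) ^ 4)⁻¹ := by
  rw [run_n, run_T, run_E]
  change 3 * (D.K.C₁₀ : ℝ) * (D.nOf ℓ) * D.T * Real.exp (-ℓ ^ eE D.ε) ≤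
    (18 * (D.K.C₁₀ : ℝ) * (D.nOf ℓ) * (Q.H : ℝ) ^ 4)⁻¹
  obtain ⟨-, -, -, -, -, -, -, hC, -, -, -, hT, -⟩ := consts_le_Cb (D := D)
  obtain ⟨hnle, -, hN⟩ := n_bounds hL
  have hC1 : (1 : ℝ) ≤ D.K.C₁₀ := by exact_mod_cast D.K.hC₁₀
  have hn1 : (1 : ℝ) ≤ D.nOf ℓ := by
    have : 1 ≤ D.nOf ℓ := le_trans (by omega) hN
    exact_mod_cast this
  have hH1 : (1 : ℝ) ≤ Q.H := by exact_mod_cast Q.one_le_H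
  have hT1 : 1 ≤ D.T := by unfold T; have := norm_nonneg (D.S.L.ω₂ / D.S.L.ω₁); linarith
  have hpos : 0 < 18 * (D.K.C₁₀ : ℝ) * (D.nOf ℓ) * (Q.H : ℝ) ^ 4 := by positivity
  rw [inv_eq_one_div, le_div_iff₀ hpos]
  -- bound the product by `exp(5 + 2 Cb + 2 ℓ^δ + Cb + 4ℓ - ℓ^{3+ε}) ≤ 1`
  have hCb := D.one_le_Cb
  have hℓ := hL.hℓ
  obtain ⟨hδ1, hδℓ⟩ := ℓδ_bounds hL
  obtain ⟨-, -, -, e4⟩ := exp_consts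
  have fC : (D.K.C₁₀ : ℝ) ≤ Real.exp D.Cb := (hC.trans (by linarith [Real.add_one_le_exp D.Cb]))
  have fn : (D.nOf ℓ : ℝ) ≤ Real.exp (ℓ ^ dδ D.ε) := by linarith [n_succ_le_exp hL]
  have fT : D.T ≤ Real.exp D.Cb := le_exp_of_log_le (by linarith) hT
  have fH : (Q.H : ℝ) ^ 4 = Real.exp (4 * ℓ) := by rw [H_eq_exp (Q := Q), ← Real.exp_nat_mul]; norm_num
  have hprod : 3 * (D.K.C₁₀ : ℝ) * (D.nOf ℓ) * D.T * Real.exp (-ℓ ^ eE D.ε) *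
      (18 * (D.K.C₁₀ : ℝ) * (D.nOf ℓ) * (Q.H : ℝ) ^ 4) =
      54 * ((D.K.C₁₀ : ℝ) * (D.K.C₁₀ : ℝ)) * ((D.nOf ℓ : ℝ) * (D.nOf ℓ)) * D.T * (Q.H : ℝ) ^ 4 *
        Real.exp (-ℓ ^ eE D.ε) := by ring
  rw [hprod, fH]
  have step : 54 * ((D.K.C₁₀ : ℝ) * (D.K.C₁₀ : ℝ)) * ((D.nOf ℓ : ℝ) * (D.nOf ℓ)) * D.T * Real.exp (4 * ℓ) *
      Real.exp (-ℓ ^ eE D.ε) ≤ Real.exp (5 + (D.Cb + D.Cb) + (ℓ ^ dδ D.ε + ℓ ^ dδ D.ε) + D.Cb + 4 * ℓ + -ℓ ^ eE D.ε) :=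
    mul_le_exp (by positivity) (mul_le_exp (by positivity) (mul_le_exp (by positivity)
      (mul_le_exp (by positivity) (mul_le_exp (by norm_num) e4 (mul_le_exp (by positivity) fC fC))
        (mul_le_exp (by positivity) fn fn)) fT) le_rfl) le_rfl
  refine step.trans ?_
  rw [show (1 : ℝ) = Real.exp 0 by simp]
  refine Real.exp_le_exp.mpr ?_
  have hS3 := hL.hS3
  obtain ⟨-, -, d3, d4, d5, -⟩ := dom le_rfl hCb hℓ (by linarith) hδℓ
  linarith

/-! #### The final inequality `hF` -/

/-- Auxiliary (`rpow_three'`). [folklore] -/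
theorem rpow_three' (u : ℝ) : ℓ ^ (3 * u) = ℓ ^ u * ℓ ^ u * ℓ ^ u := by
  rw [show 3 * u = u + u + u by ring, rpow_add' hL, rpow_add' hL]

/-- `G₂ ≤ 3 e^{-ℓ^{a₁} ℓ^{g₁}/24}`. [cite: Masser1975, Lemma 1.11] -/
theorem G₂_le : (D.run Q).G₂ ≤ 3 * Real.exp (-(ℓ ^ ea₁ D.ε * ℓ ^ eg₁ D.ε / 24)) := by
  rw [Run.G₂_eq, run_k₁, run_h₁]
  obtain ⟨-, -, -, -, hbg₁a₁, haa₁, -, -, hb0⟩ := D.exps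
  obtain ⟨-, -, hnk₁, -⟩ := params_order hL
  exact Ggen_le_three hL hL.h2a₁ hL.h2g₁ hnk₁ haa₁ le_rfl (by linarith) hL.hE4 hL.hE6 hL.hH1 hL.hH2

/-- `G₁ ≤ 3 e^{-ℓ^{a} ℓ^{g}/24}`. [cite: Masser1975, Lemma 1.10] -/
theorem G₁_le : (D.run Q).G₁ ≤ 3 * Real.exp (-(ℓ ^ ea D.ε * ℓ ^ eg D.ε / 24)) := by
  rw [Run.G₁_eq, run_k, run_h]
  obtain ⟨hg1, hbga, -, -, -, haa₁, hd0, -, hb0⟩ := D.exps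
  obtain ⟨hnk, -⟩ := params_order hL
  have i4 : 350 * D.Cb * ℓ ^ (ea D.ε + dδ D.ε) ≤ ℓ ^ eE D.ε :=
    le_trans (mul_le_mul_of_nonneg_left (rpow_mono hL (by linarith)) (by linarith [D.one_le_Cb])) hL.hE6
  exact Ggen_le_three hL hL.h2a hL.h2g hnk le_rfl haa₁ (by linarith) hL.hE1 i4 hL.hG1 hL.hG2

omit hL in
/-- The `σ`-factor: `cσ⁻¹ e^{Cσ X} ≤ e^{Cb + Cb X}` for `X ≥ 0`. [folklore] -/
theorem sigma_factor_le {X : ℝ} (hX : 0 ≤ X) :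
    D.K.cσ⁻¹ * Real.exp (D.K.Cσ * X) ≤ Real.exp (D.Cb + D.Cb * X) := by
  obtain ⟨-, -, -, -, hCσ, hcσ, -⟩ := consts_le_Cb (D := D)
  have h1 : D.K.cσ⁻¹ ≤ Real.exp D.Cb := by
    refine le_exp_of_log_le (inv_pos.mpr D.K.hcσ) ?_
    rw [Real.log_inv]
    exact (neg_le_abs _).trans hcσ
  exact mul_le_exp (inv_pos.mpr D.K.hcσ).le h1 (Real.exp_le_exp.mpr (mul_le_mul_of_nonneg_right hCσ hX))

/-- `κ n²/μ ≤ e^{14 Cb ℓ}`. [cite: Masser1975, §1.3 (end: "μ > H^{-c₂₉}")] -/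
theorem kappa_div_mu_le : 0 ≤ (D.run Q).K.κ * ((D.run Q).n : ℝ) ^ 2 / (D.run Q).μ ∧
    (D.run Q).K.κ * ((D.run Q).n : ℝ) ^ 2 / (D.run Q).μ ≤ Real.exp (14 * D.Cb * ℓ) := by
  obtain ⟨-, -, -, -, -, -, -, hC, hκ, -, -, -, -, hT₀, -⟩ := consts_le_Cb (D := D)
  obtain ⟨hnle, -, hN⟩ := n_bounds hL
  have hn1 : (1 : ℝ) ≤ D.nOf ℓ := by
    have : 1 ≤ D.nOf ℓ := le_trans (by omega) hN
    exact_mod_cast this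
  have hC1 : (1 : ℝ) ≤ D.K.C₁₀ := by exact_mod_cast D.K.hC₁₀
  have hH1 : (1 : ℝ) ≤ Q.H := by exact_mod_cast Q.one_le_H
  have hω : 0 < ‖D.S.L.ω₁‖ := norm_pos_iff.mpr (by simpa using basis_ne_zero D.S.L 0)
  have hκ0 := D.K.hκ
  have heq : (D.run Q).K.κ * ((D.run Q).n : ℝ) ^ 2 / (D.run Q).μ =
      D.K.κ * ((D.nOf ℓ : ℝ) * (D.nOf ℓ)) * (18 * (D.K.C₁₀ * ((D.nOf ℓ : ℝ) * (Q.H : ℝ) ^ 4))) *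
        (‖D.S.L.ω₁‖⁻¹ * ‖D.S.L.ω₁‖⁻¹) := by
    change D.K.κ * ((D.nOf ℓ : ℝ)) ^ 2 / (‖D.S.L.ω₁‖ ^ 2 * (18 * (D.K.C₁₀ : ℝ) * (D.nOf ℓ) * (Q.H : ℝ) ^ 4)⁻¹) = _
    field_simp
  refine ⟨by rw [heq]; positivity, ?_⟩
  rw [heq]
  have hCb := D.one_le_Cb
  have hℓ := hL.hℓ
  obtain ⟨hδ1, hδℓ⟩ := ℓδ_bounds hL
  obtain ⟨-, -, e3, -⟩ := exp_consts
  have fκ : D.K.κ ≤ Real.exp D.Cb := le_exp_of_log_le hκ0 ((le_abs_self _).trans hκ)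
  have fn : (D.nOf ℓ : ℝ) ≤ Real.exp (ℓ ^ dδ D.ε) := by linarith [n_succ_le_exp hL]
  have fC : (D.K.C₁₀ : ℝ) ≤ Real.exp D.Cb := (hC.trans (by linarith [Real.add_one_le_exp D.Cb]))
  have fH : (Q.H : ℝ) ^ 4 ≤ Real.exp (4 * ℓ) := by rw [H_eq_exp (Q := Q), ← Real.exp_nat_mul]; norm_num
  have fω : ‖D.S.L.ω₁‖⁻¹ ≤ Real.exp D.Cb :=
    (le_max_right 1 _).trans (le_exp_of_log_le (lt_of_lt_of_le one_pos (le_max_left _ _)) hT₀)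
  have step := mul_le_exp (by positivity) (mul_le_exp (by positivity) (mul_le_exp hκ0.le fκ (mul_le_exp (by positivity) fn fn))
    (mul_le_exp (by norm_num) e3 (mul_le_exp (by positivity) fC (mul_le_exp (by positivity) fn fH))))
    (mul_le_exp (by positivity) fω fω)
  refine step.trans (Real.exp_le_exp.mpr ?_)
  obtain ⟨d1, -, d3, d4, d5, -⟩ := dom le_rfl hCb hℓ (by linarith) hδℓ
  linarith

/-- `MΦ ≤ 3 e^{-Y₂} e^{4n(2Cb + Cb³ n²)}`. [cite: Masser1975, Lemma 1.11] -/
theorem MΦ_le : (D.run Q).MΦ ≤ 3 * Real.exp (-(ℓ ^ ea₁ D.ε * ℓ ^ eg₁ D.ε / 24)) *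
    Real.exp (((4 * D.nOf ℓ : ℕ) : ℝ) * (D.Cb + D.Cb * (1 + (D.Cb * D.nOf ℓ) ^ 2))) := by
  obtain ⟨-, -, -, -, -, -, -, -, -, hR, -⟩ := consts_le_Cb (D := D)
  have hG := G₂_le hL
  have hG0 : 0 ≤ (D.run Q).G₂ := by
    rw [Run.G₂_eq]; unfold Run.Ggen
    have := ηgen_nonneg' (D := D) (Q := Q) (D.run Q).k₁ (D.run Q).h₁
    have := xiFactor_nonneg (D.run Q).h₁ ((D.run Q).k₁ + 1)
    have : 0 ≤ (D.run Q).Θgen (D.run Q).h₁ := by unfold Run.Θgen; have := (D.run Q).Pc_nonneg; positivity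
    positivity
  have hf : D.K.cσ⁻¹ * Real.exp (D.K.Cσ * (1 + (D.K.R * D.nOf ℓ) ^ 2)) ≤
      Real.exp (D.Cb + D.Cb * (1 + (D.Cb * D.nOf ℓ) ^ 2)) := by
    refine (sigma_factor_le (D := D) (X := 1 + (D.K.R * D.nOf ℓ) ^ 2) (by positivity)).trans
      (Real.exp_le_exp.mpr ?_)
    have h1 : (D.K.R * D.nOf ℓ) ^ 2 ≤ (D.Cb * D.nOf ℓ) ^ 2 :=
      pow_le_pow_left₀ (mul_nonneg D.K.hR.le (Nat.cast_nonneg _)) (mul_le_mul_of_nonneg_right hR (Nat.cast_nonneg _)) 2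
    have hCb0 : 0 ≤ D.Cb := zero_le_one.trans D.one_le_Cb
    nlinarith
  change (D.run Q).G₂ * (D.K.cσ⁻¹ * Real.exp (D.K.Cσ * (1 + (D.K.R * D.nOf ℓ) ^ 2))) ^ (4 * D.nOf ℓ) ≤ _
  have hc0 : 0 ≤ D.K.cσ⁻¹ * Real.exp (D.K.Cσ * (1 + (D.K.R * D.nOf ℓ) ^ 2)) := by
    have := D.K.hcσ; positivity
  exact mul_le_mul hG (pow_le_exp hc0 hf _) (pow_nonneg hc0 _) (by positivity)

/-- `Pb^{h₀ - 1} ≤ e^{14 Cb² k ℓ}`. [folklore] -/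
theorem Pb_pow_le : D.S.Pb Q (D.nOf ℓ) (D.kOf ℓ) ^ (D.S.G.h - 1) ≤ Real.exp (D.Cb * (14 * D.Cb * D.kOf ℓ * ℓ)) := by
  obtain ⟨-, -, hh0, -⟩ := consts_le_Cb (D := D)
  have h1 := pow_le_exp (zero_le_one.trans (D.S.one_le_Pb Q _ _)) (Pb_le hL) (D.S.G.h - 1)
  refine h1.trans (Real.exp_le_exp.mpr (mul_le_mul_of_nonneg_right ?_ ?_))
  · have : ((D.S.G.h - 1 : ℕ) : ℝ) ≤ D.S.G.h := by exact_mod_cast Nat.sub_le _ _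
    exact this.trans hh0
  · have := D.one_le_Cb; have := hL.hℓ; positivity

/-- **`hF`**: `(κ n²/μ)^n MΦ < Pb^{-(h₀-1)}`. [cite: Masser1975, §1.3 (end of the proof of Thm I)] -/
theorem hyp_F : ((D.run Q).K.κ * ((D.run Q).n : ℝ) ^ 2 / (D.run Q).μ) ^ (D.run Q).n * (D.run Q).MΦ <
    ((D.run Q).S.Pb (D.run Q).Q (D.run Q).n (D.run Q).k ^ ((D.run Q).S.G.h - 1))⁻¹ := by
  change _ < (D.S.Pb Q (D.nOf ℓ) (D.kOf ℓ) ^ (D.S.G.h - 1))⁻¹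
  have hPb0 : 0 < D.S.Pb Q (D.nOf ℓ) (D.kOf ℓ) ^ (D.S.G.h - 1) := pow_pos (lt_of_lt_of_le one_pos (D.S.one_le_Pb Q _ _)) _
  rw [inv_eq_one_div, lt_div_iff₀ hPb0]
  obtain ⟨hq0, hq⟩ := kappa_div_mu_le hL
  have f1 := pow_le_exp hq0 hq (D.nOf ℓ)
  have f2 := MΦ_le hL
  have f3 := Pb_pow_le hL
  have hM0 : 0 ≤ (D.run Q).MΦ := by
    change 0 ≤ (D.run Q).G₂ * (D.K.cσ⁻¹ * Real.exp (D.K.Cσ * (1 + (D.K.R * D.nOf ℓ) ^ 2))) ^ (4 * D.nOf ℓ)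
    have hG0 : 0 ≤ (D.run Q).G₂ := by
      rw [Run.G₂_eq]; unfold Run.Ggen
      have := ηgen_nonneg' (D := D) (Q := Q) (D.run Q).k₁ (D.run Q).h₁
      have := xiFactor_nonneg (D.run Q).h₁ ((D.run Q).k₁ + 1)
      have : 0 ≤ (D.run Q).Θgen (D.run Q).h₁ := by unfold Run.Θgen; have := (D.run Q).Pc_nonneg; positivity
      positivity
    have := D.K.hcσ
    positivity
  -- combine into a single exponential
  set Y := ℓ ^ ea₁ D.ε * ℓ ^ eg₁ D.ε / 24 with hY
  have step : ((D.run Q).K.κ * ((D.run Q).n : ℝ) ^ 2 / (D.run Q).μ) ^ (D.run Q).n * (D.run Q).MΦ *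
      D.S.Pb Q (D.nOf ℓ) (D.kOf ℓ) ^ (D.S.G.h - 1) ≤
      3 * Real.exp (((D.nOf ℓ : ℕ) : ℝ) * (14 * D.Cb * ℓ) + (-Y + ((4 * D.nOf ℓ : ℕ) : ℝ) *
        (D.Cb + D.Cb * (1 + (D.Cb * D.nOf ℓ) ^ 2))) + D.Cb * (14 * D.Cb * D.kOf ℓ * ℓ)) := by
    have e2 : (D.run Q).MΦ ≤ Real.exp (Real.log 3 + (-Y + ((4 * D.nOf ℓ : ℕ) : ℝ) *
        (D.Cb + D.Cb * (1 + (D.Cb * D.nOf ℓ) ^ 2)))) := by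
      refine f2.trans (le_of_eq ?_)
      rw [Real.exp_add, Real.exp_add, Real.exp_log (by norm_num)]; ring
    have := mul_le_exp (mul_nonneg (pow_nonneg hq0 _) hM0) (mul_le_exp (pow_nonneg hq0 _) f1 e2) f3
    have key : ∀ A B C : ℝ, Real.exp (A + (Real.log 3 + B) + C) = 3 * Real.exp (A + B + C) := fun A B C => by
      rw [show A + (Real.log 3 + B) + C = Real.log 3 + (A + B + C) by ring, Real.exp_add, Real.exp_log (by norm_num)]
    rw [key] at this
    exact this
  refine lt_of_le_of_lt step ?_
  -- the exponent is `≤ -2`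
  obtain ⟨hnle, -, hN⟩ := n_bounds hL
  obtain ⟨hkle, -, -⟩ := k_bounds hL
  have hCb := D.one_le_Cb
  have hCb0 : 0 ≤ D.Cb := by linarith
  have hℓ := hL.hℓ
  have hℓ0 := ℓ_pos hL
  have hH1 := hL.hH1
  have hH3 := hL.hH3
  have hH4 := hL.hH4
  rw [rpow_add' hL, Real.rpow_one, rpow_add' hL] at hH1 hH4
  rw [rpow_three' hL, rpow_add' hL] at hH3
  have hb1 : 1 ≤ ℓ ^ eb D.ε := one_le_rpow' hL (D.exps).2.2.2.2.2.2.2.2.le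
  have hn0 : (0 : ℝ) ≤ D.nOf ℓ := Nat.cast_nonneg _
  -- monomial facts
  have m1 : D.Cb * (D.nOf ℓ : ℝ) * ℓ ≤ D.Cb * (ℓ ^ eb D.ε * ℓ) := by
    have := mul_le_mul_of_nonneg_left (mul_le_mul_of_nonneg_right hnle hℓ0.le) hCb0; linarith
  have m1' : D.Cb * (ℓ ^ eb D.ε * ℓ) ≤ D.Cb ^ 2 * (ℓ ^ eb D.ε * ℓ) :=
    mul_le_mul_of_nonneg_right (le_self_pow₀ hCb two_ne_zero) (by positivity)
  have m2 : D.Cb * (D.nOf ℓ : ℝ) ≤ D.Cb * (ℓ ^ eb D.ε * ℓ) := by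
    have : (D.nOf ℓ : ℝ) ≤ ℓ ^ eb D.ε * ℓ := hnle.trans (le_mul_of_one_le_right (by positivity) hℓ)
    exact mul_le_mul_of_nonneg_left this hCb0
  have m3 : D.Cb ^ 3 * (D.nOf ℓ : ℝ) ^ 3 ≤ D.Cb ^ 3 * (ℓ ^ eb D.ε * ℓ ^ eb D.ε * ℓ ^ eb D.ε) := by
    have : (D.nOf ℓ : ℝ) ^ 3 ≤ (ℓ ^ eb D.ε) ^ 3 := pow_le_pow_left₀ hn0 hnle 3
    have h3 : (ℓ ^ eb D.ε) ^ 3 = ℓ ^ eb D.ε * ℓ ^ eb D.ε * ℓ ^ eb D.ε := by ring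
    rw [← h3]; exact mul_le_mul_of_nonneg_left this (by positivity)
  have m4 : D.Cb ^ 2 * (D.kOf ℓ : ℝ) * ℓ ≤ D.Cb ^ 2 * (ℓ ^ ea D.ε * ℓ) := by
    have := mul_le_mul_of_nonneg_left (mul_le_mul_of_nonneg_right hkle hℓ0.le) (pow_nonneg hCb0 2); linarith
  have m5 : 1 ≤ D.Cb ^ 2 * (ℓ ^ eb D.ε * ℓ) := by
    have : (1 : ℝ) ≤ D.Cb ^ 2 := one_le_pow₀ hCb
    have : (1 : ℝ) ≤ ℓ ^ eb D.ε * ℓ := one_le_mul_of_one_le_of_one_le hb1 hℓ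
    nlinarith
  have hexp : ((D.nOf ℓ : ℕ) : ℝ) * (14 * D.Cb * ℓ) + (-Y + ((4 * D.nOf ℓ : ℕ) : ℝ) *
      (D.Cb + D.Cb * (1 + (D.Cb * D.nOf ℓ) ^ 2))) + D.Cb * (14 * D.Cb * D.kOf ℓ * ℓ) ≤ -2 := by
    push_cast
    have hYAG : 0 ≤ ℓ ^ ea₁ D.ε * ℓ ^ eg₁ D.ε := by positivity
    nlinarith [m1, m1', m2, m3, m4, m5, hH1, hH3, hH4]
  obtain ⟨-, e2, -⟩ := exp_consts
  calc 3 * Real.exp _ ≤ 3 * Real.exp (-2) := by gcongr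
    _ < 1 := by
        rw [Real.exp_neg, ← div_eq_mul_inv, div_lt_one (Real.exp_pos 2)]; linarith

/-! #### The Liouville inequality `hL1` -/

omit hL in
/-- `0 ≤ Ggen`. [folklore] -/
theorem Ggen_nonneg' (K hh : ℕ) : 0 ≤ (D.run Q).Ggen K hh := by
  unfold Run.Ggen
  have := ηgen_nonneg' (D := D) (Q := Q) K hh
  have := xiFactor_nonneg hh (K + 1)
  have : 0 ≤ (D.run Q).Θgen hh := by unfold Run.Θgen; have := (D.run Q).Pc_nonneg; positivity
  positivity

/-- `Bc ≤ e^{26 Cb k₁ ℓ}`. [cite: Masser1975, §1.3 (Lemma 1.10: "size at most H^{c₂₁k₁}")] -/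
theorem Bc_le : (D.run Q).Bc ≤ Real.exp (26 * D.Cb * D.k₁Of ℓ * ℓ) := by
  obtain ⟨hnk, hkk₁, hnk₁, -, -, -⟩ := params_order hL
  obtain ⟨hk₁le, -, hk₁1⟩ := k₁_bounds hL
  obtain ⟨-, -, -, hkℓ', -⟩ := params_order hL
  have hk₁ℓ : (D.k₁Of ℓ : ℝ) ≤ ℓ ^ ea₁ D.ε := hk₁le
  have hCb := D.one_le_Cb
  have hℓ := hL.hℓ
  obtain ⟨hδ1, hδℓ⟩ := ℓδ_bounds hL
  have hsq : ((((D.nOf ℓ) + 1) ^ 2 : ℕ) : ℝ) ≤ Real.exp (2 * ℓ ^ dδ D.ε) := by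
    have h := pow_le_exp (by positivity) (n_succ_le_exp hL) 2
    push_cast at h ⊢; simpa using h
  have hA := Amat_le hL hnk₁ hk₁1 hk₁ℓ
  have hP := Pb_le hL
  have hkk₁' : (D.kOf ℓ : ℝ) ≤ D.k₁Of ℓ := by exact_mod_cast hkk₁
  have hk₁1' : (1 : ℝ) ≤ D.k₁Of ℓ := by exact_mod_cast hk₁1
  change ((((D.nOf ℓ) + 1) ^ 2 : ℕ) : ℝ) * D.S.Pb Q (D.nOf ℓ) (D.kOf ℓ) * D.S.Amat Q (D.nOf ℓ) (D.k₁Of ℓ) ≤ _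
  have hPb0 : 0 ≤ D.S.Pb Q (D.nOf ℓ) (D.kOf ℓ) := zero_le_one.trans (D.S.one_le_Pb Q _ _)
  refine (mul_le_exp (mul_nonneg (by positivity) hPb0) (mul_le_exp (by positivity) hsq hP) hA).trans
    (Real.exp_le_exp.mpr ?_)
  obtain ⟨-, -, -, -, d5, -⟩ := dom hk₁1' hCb hℓ (by linarith) hδℓ
  have : D.Cb * (D.kOf ℓ : ℝ) * ℓ ≤ D.Cb * (D.k₁Of ℓ) * ℓ := by
    have := mul_le_mul_of_nonneg_left (mul_le_mul_of_nonneg_right hkk₁' (by linarith : (0:ℝ) ≤ ℓ)) (by linarith : 0 ≤ D.Cb)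
    linarith
  nlinarith

/-- The Liouville denominator `W = (3H²Bc⁴)^{h₀-1} (4 H Bc²) ≤ e^{108 Cb² k₁ ℓ + 55 Cb k₁ ℓ}`. [folklore] -/
theorem W_le : (3 * ((D.run Q).Q.H : ℝ) ^ 2 * (D.run Q).Bc ^ 2 * (D.run Q).Bc ^ 2) ^ ((D.run Q).S.G.h - 1) *
    (4 * (D.run Q).Q.H * (D.run Q).Bc * (D.run Q).Bc) ≤
    Real.exp (D.Cb * (108 * D.Cb * D.k₁Of ℓ * ℓ) + 55 * D.Cb * D.k₁Of ℓ * ℓ) := by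
  obtain ⟨-, -, hh0, -⟩ := consts_le_Cb (D := D)
  have hBc := Bc_le hL
  have hBc0 : 0 ≤ (D.run Q).Bc := zero_le_one.trans (hyp_Bc (D := D) (Q := Q))
  obtain ⟨-, -, hk₁1⟩ := k₁_bounds hL
  have hk₁1' : (1 : ℝ) ≤ D.k₁Of ℓ := by exact_mod_cast hk₁1
  have hCb := D.one_le_Cb
  have hℓ := hL.hℓ
  obtain ⟨e1, e2, -⟩ := exp_consts
  have fH : ((D.run Q).Q.H : ℝ) = Real.exp ℓ := H_eq_exp (Q := Q)
  have f3 : (3 : ℝ) ≤ Real.exp 2 := by linarith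
  have f4 : (4 : ℝ) ≤ Real.exp 2 := by linarith
  have fH2 : ((D.run Q).Q.H : ℝ) ^ 2 ≤ Real.exp (2 * ℓ) := by rw [fH, ← Real.exp_nat_mul]; norm_num
  have fH1 : ((D.run Q).Q.H : ℝ) ≤ Real.exp ℓ := fH.le
  have fB2 : (D.run Q).Bc ^ 2 ≤ Real.exp (2 * (26 * D.Cb * D.k₁Of ℓ * ℓ)) := by
    have := pow_le_exp hBc0 hBc 2; simpa using this
  obtain ⟨d1, -, d3, d4, -⟩ := dom hk₁1' hCb hℓ (by linarith) le_rfl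
  have inner : 3 * ((D.run Q).Q.H : ℝ) ^ 2 * (D.run Q).Bc ^ 2 * (D.run Q).Bc ^ 2 ≤
      Real.exp (108 * D.Cb * D.k₁Of ℓ * ℓ) := by
    refine (mul_le_exp (by positivity) (mul_le_exp (by positivity) (mul_le_exp (by norm_num) f3 fH2) fB2) fB2).trans
      (Real.exp_le_exp.mpr ?_)
    linarith
  have hpow := pow_le_exp (by positivity) inner ((D.run Q).S.G.h - 1)
  have hpow' : (3 * ((D.run Q).Q.H : ℝ) ^ 2 * (D.run Q).Bc ^ 2 * (D.run Q).Bc ^ 2) ^ ((D.run Q).S.G.h - 1) ≤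
      Real.exp (D.Cb * (108 * D.Cb * D.k₁Of ℓ * ℓ)) := by
    refine hpow.trans (Real.exp_le_exp.mpr (mul_le_mul_of_nonneg_right ?_ (by positivity)))
    have : (((D.run Q).S.G.h - 1 : ℕ) : ℝ) ≤ D.S.G.h := by exact_mod_cast Nat.sub_le _ _
    exact this.trans hh0
  have outer : 4 * ((D.run Q).Q.H : ℝ) * (D.run Q).Bc * (D.run Q).Bc ≤ Real.exp (55 * D.Cb * D.k₁Of ℓ * ℓ) := by
    refine (mul_le_exp (by positivity) (mul_le_exp (by positivity) (mul_le_exp (by norm_num) f4 fH1) hBc) hBc).trans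
      (Real.exp_le_exp.mpr ?_)
    linarith
  exact mul_le_exp (by positivity) hpow' outer

/-- `|d|^{2n+k₁} H^{k₁} ≤ e^{3 Cb k₁ ℓ + k₁ ℓ}`. [folklore] -/
theorem dH_le : (|(D.S.d : ℝ)|) ^ (2 * D.nOf ℓ + D.k₁Of ℓ) * (Q.H : ℝ) ^ D.k₁Of ℓ ≤
    Real.exp (3 * D.Cb * D.k₁Of ℓ * ℓ + D.k₁Of ℓ * ℓ) := by
  obtain ⟨hC0, -⟩ := consts_le_Cb (D := D)
  obtain ⟨-, -, hnk₁, -⟩ := params_order hL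
  have hnk₁' : (D.nOf ℓ : ℝ) ≤ D.k₁Of ℓ := by exact_mod_cast hnk₁
  have hCb := D.one_le_Cb
  have hℓ := hL.hℓ
  have hd1 : (1 : ℝ) ≤ |(D.S.d : ℝ)| := D.S.G.one_le_abs_den
  have hdC : |(D.S.d : ℝ)| ≤ D.S.C₀ := by
    unfold TSetup.C₀
    exact le_mul_of_one_le_right (by positivity) D.S.G.one_le_M
  have fd : |(D.S.d : ℝ)| ≤ Real.exp D.Cb :=
    le_exp_of_log_le (by linarith) ((Real.log_le_log (by linarith) hdC).trans hC0)
  have hH0 : (0 : ℝ) < Q.H := by exact_mod_cast Q.one_le_H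
  have fH : (Q.H : ℝ) ^ D.k₁Of ℓ = Real.exp ((D.k₁Of ℓ : ℝ) * ℓ) := by
    rw [← Real.exp_log (pow_pos hH0 _), Real.log_pow]
  rw [fH]
  refine (mul_le_exp (by positivity) (pow_le_exp (by positivity) fd _) le_rfl).trans (Real.exp_le_exp.mpr ?_)
  push_cast
  have hCb0 : 0 ≤ D.Cb := by linarith
  have h1 : (D.nOf ℓ : ℝ) * D.Cb ≤ (D.k₁Of ℓ) * D.Cb := mul_le_mul_of_nonneg_right hnk₁' hCb0
  have h2 : (D.k₁Of ℓ : ℝ) * D.Cb ≤ (D.k₁Of ℓ : ℝ) * D.Cb * ℓ := le_mul_of_one_le_right (by positivity) hℓ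
  linarith

/-- `B₁ ≤ 3 e^{-Y₁} e^{12 Cb n}`. [cite: Masser1975, Lemma 1.10] -/
theorem B₁_le : 0 ≤ (D.run Q).B₁ ∧ (D.run Q).B₁ ≤ 3 * Real.exp (-(ℓ ^ ea D.ε * ℓ ^ eg D.ε / 24)) *
    Real.exp (((4 * D.nOf ℓ : ℕ) : ℝ) * (D.Cb + D.Cb * 2)) := by
  have hG := G₁_le hL
  have hG0 : 0 ≤ (D.run Q).G₁ := by rw [Run.G₁_eq]; exact Ggen_nonneg' _ _
  have hf := sigma_factor_le (D := D) (X := 2) (by norm_num)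
  have hc0 : 0 ≤ D.K.cσ⁻¹ * Real.exp (D.K.Cσ * 2) := by have := D.K.hcσ; positivity
  change 0 ≤ (D.run Q).G₁ * (D.K.cσ⁻¹ * Real.exp (D.K.Cσ * 2)) ^ (4 * D.nOf ℓ) ∧
    (D.run Q).G₁ * (D.K.cσ⁻¹ * Real.exp (D.K.Cσ * 2)) ^ (4 * D.nOf ℓ) ≤ _
  exact ⟨mul_nonneg hG0 (pow_nonneg hc0 _),
    mul_le_mul hG (pow_le_exp hc0 hf _) (pow_nonneg hc0 _) (by positivity)⟩

/-- `U ≤ 3 e^{Za} + e^{Zb}` with the explicit exponents of the two terms. [cite: Masser1975, Lemma 1.10] -/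
theorem U_le : (D.run Q).U ≤
    3 * Real.exp ((D.k₁Of ℓ : ℝ) * D.Cb + (D.k₁Of ℓ : ℝ) * ℓ ^ dδ D.ε +
      (-(ℓ ^ ea D.ε * ℓ ^ eg D.ε / 24) + ((4 * D.nOf ℓ : ℕ) : ℝ) * (D.Cb + D.Cb * 2)) + (D.k₁Of ℓ : ℝ) * D.Cb) +
    Real.exp (16 * D.Cb * D.kOf ℓ * ℓ + 10 * D.Cb * D.k₁Of ℓ * ℓ ^ dδ D.ε + -ℓ ^ eE D.ε) := by
  obtain ⟨-, -, -, -, -, -, -, -, -, -, hρ, -, -, hT₀, -⟩ := consts_le_Cb (D := D)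
  obtain ⟨-, -, hnk₁, -, -, -⟩ := params_order hL
  obtain ⟨hk₁le, -, hk₁1⟩ := k₁_bounds hL
  have hk₁ℓ : (D.k₁Of ℓ : ℝ) ≤ ℓ ^ ea₁ D.ε := hk₁le
  obtain ⟨hB0, hB⟩ := B₁_le hL
  -- term a
  have fT₀ : (D.run Q).T₀ ^ D.k₁Of ℓ ≤ Real.exp ((D.k₁Of ℓ : ℝ) * D.Cb) :=
    pow_le_exp (zero_le_one.trans (le_max_left _ _)) (le_exp_of_log_le (lt_of_lt_of_le one_pos (le_max_left _ _)) hT₀) _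
  have fk : ((D.k₁Of ℓ).factorial : ℝ) ≤ Real.exp ((D.k₁Of ℓ : ℝ) * ℓ ^ dδ D.ε) := by
    have h1 : ((D.k₁Of ℓ).factorial : ℝ) ≤ (D.k₁Of ℓ : ℝ) ^ D.k₁Of ℓ := by exact_mod_cast Nat.factorial_le_pow _
    refine h1.trans (pow_le_exp (Nat.cast_nonneg _) ?_ _)
    have : (D.k₁Of ℓ : ℝ) + 1 ≤ Real.exp (ℓ ^ dδ D.ε) :=
      le_exp_of_log_le (by positivity) (log_small hL (by positivity) hk₁ℓ hk₁ℓ (by nlinarith [Nat.cast_nonneg (α := ℝ) (D.k₁Of ℓ)]))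
    linarith
  have fρ : (D.K.d.ρ⁻¹) ^ D.k₁Of ℓ ≤ Real.exp ((D.k₁Of ℓ : ℝ) * D.Cb) :=
    pow_le_exp (inv_pos.mpr D.K.d.ρ_pos).le (le_exp_of_log_le (inv_pos.mpr D.K.d.ρ_pos) hρ) _
  have fB : (D.run Q).B₁ ≤ Real.exp (Real.log 3 + (-(ℓ ^ ea D.ε * ℓ ^ eg D.ε / 24) +
      ((4 * D.nOf ℓ : ℕ) : ℝ) * (D.Cb + D.Cb * 2))) := by
    refine hB.trans (le_of_eq ?_); rw [Real.exp_add, Real.exp_add, Real.exp_log (by norm_num)]; ring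
  have ha : (D.run Q).T₀ ^ D.k₁Of ℓ * ((D.k₁Of ℓ).factorial * (D.run Q).B₁ / D.K.d.ρ ^ D.k₁Of ℓ) ≤
      3 * Real.exp ((D.k₁Of ℓ : ℝ) * D.Cb + (D.k₁Of ℓ : ℝ) * ℓ ^ dδ D.ε +
        (-(ℓ ^ ea D.ε * ℓ ^ eg D.ε / 24) + ((4 * D.nOf ℓ : ℕ) : ℝ) * (D.Cb + D.Cb * 2)) + (D.k₁Of ℓ : ℝ) * D.Cb) := by
    rw [div_eq_mul_inv, ← inv_pow]
    have := mul_le_exp (pow_nonneg (zero_le_one.trans (le_max_left _ _)) _) fT₀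
      (mul_le_exp (mul_nonneg (Nat.cast_nonneg _) hB0) (mul_le_exp (Nat.cast_nonneg _) fk fB) fρ)
    refine this.trans (le_of_eq ?_)
    have key : ∀ A B C E : ℝ, Real.exp (A + (B + (Real.log 3 + C) + E)) = 3 * Real.exp (A + B + C + E) :=
      fun A B C E => by
        rw [show A + (B + (Real.log 3 + C) + E) = Real.log 3 + (A + B + C + E) by ring, Real.exp_add,
          Real.exp_log (by norm_num)]
    rw [key]
  -- term b
  have hb : (D.run Q).Pc * Dcomp D.S D.T (D.nOf ℓ) (D.k₁Of ℓ) * (D.run Q).E ≤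
      Real.exp (16 * D.Cb * D.kOf ℓ * ℓ + 10 * D.Cb * D.k₁Of ℓ * ℓ ^ dδ D.ε + -ℓ ^ eE D.ε) :=
    mul_le_exp (mul_nonneg (D.run Q).Pc_nonneg (Dcomp_nonneg D.S (by
      unfold T; have := norm_nonneg (D.S.L.ω₂ / D.S.L.ω₁); linarith) _ _))
      (mul_le_exp (D.run Q).Pc_nonneg (Pc_le hL) (Dcomp_le hL hnk₁ hk₁1 hk₁ℓ)) (le_of_eq (run_E (D := D)))
  change (D.run Q).T₀ ^ D.k₁Of ℓ * ((D.k₁Of ℓ).factorial * (D.run Q).B₁ / D.K.d.ρ ^ D.k₁Of ℓ) +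
    (D.run Q).Pc * Dcomp D.S (D.run Q).T (D.nOf ℓ) (D.k₁Of ℓ) * (D.run Q).E ≤ _
  rw [run_T]
  exact add_le_add ha hb

/-- **`hL1`**: `|d|^{2n+k₁} H^{k₁} U < Λ₁`. [cite: Masser1975, §1.3 (proof of Lemma 1.10)] -/
theorem hyp_L1 : (|((D.run Q).S.d : ℝ)|) ^ (2 * (D.run Q).n + (D.run Q).k₁) * ((D.run Q).Q.H : ℝ) ^ (D.run Q).k₁ *
    (D.run Q).U < (D.run Q).Λ₁ := by
  have hBc0 : 0 < (D.run Q).Bc := lt_of_lt_of_le one_pos (hyp_Bc (D := D) (Q := Q))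
  have hH0 : (0 : ℝ) < (D.run Q).Q.H := by exact_mod_cast Q.one_le_H
  have hW0 : 0 < (3 * ((D.run Q).Q.H : ℝ) ^ 2 * (D.run Q).Bc ^ 2 * (D.run Q).Bc ^ 2) ^ ((D.run Q).S.G.h - 1) *
      (4 * (D.run Q).Q.H * (D.run Q).Bc * (D.run Q).Bc) := by positivity
  unfold Run.Λ₁
  rw [inv_eq_one_div, lt_div_iff₀ hW0]
  have hW := W_le hL
  have hdH := dH_le hL
  have hU := U_le hL
  have hU0 : 0 ≤ (D.run Q).U := by
    change 0 ≤ (D.run Q).T₀ ^ D.k₁Of ℓ * ((D.k₁Of ℓ).factorial * (D.run Q).B₁ / D.K.d.ρ ^ D.k₁Of ℓ) +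
      (D.run Q).Pc * Dcomp D.S (D.run Q).T (D.nOf ℓ) (D.k₁Of ℓ) * (D.run Q).E
    have := (B₁_le hL).1
    have := (D.run Q).Pc_nonneg
    have : 0 ≤ Dcomp D.S (D.run Q).T (D.nOf ℓ) (D.k₁Of ℓ) := Dcomp_nonneg D.S (zero_le_one.trans (D.run Q).one_le_T) _ _
    have : 0 ≤ (D.run Q).E := Real.exp_nonneg _
    have : 0 ≤ (D.run Q).T₀ ^ D.k₁Of ℓ := pow_nonneg (zero_le_one.trans (le_max_left _ _)) _
    have := D.K.d.ρ_pos
    positivity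
  change (|(D.S.d : ℝ)|) ^ (2 * D.nOf ℓ + D.k₁Of ℓ) * (Q.H : ℝ) ^ D.k₁Of ℓ * (D.run Q).U * _ < 1
  -- `Z = 3 Cb k₁ ℓ + k₁ ℓ + 108 Cb² k₁ ℓ + 55 Cb k₁ ℓ`
  set Z := 3 * D.Cb * D.k₁Of ℓ * ℓ + D.k₁Of ℓ * ℓ + (D.Cb * (108 * D.Cb * D.k₁Of ℓ * ℓ) + 55 * D.Cb * D.k₁Of ℓ * ℓ)
    with hZ
  have hZW : (|(D.S.d : ℝ)|) ^ (2 * D.nOf ℓ + D.k₁Of ℓ) * (Q.H : ℝ) ^ D.k₁Of ℓ *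
      ((3 * ((D.run Q).Q.H : ℝ) ^ 2 * (D.run Q).Bc ^ 2 * (D.run Q).Bc ^ 2) ^ ((D.run Q).S.G.h - 1) *
      (4 * (D.run Q).Q.H * (D.run Q).Bc * (D.run Q).Bc)) ≤ Real.exp Z := mul_le_exp (by positivity) hdH hW
  set Za := (D.k₁Of ℓ : ℝ) * D.Cb + (D.k₁Of ℓ : ℝ) * ℓ ^ dδ D.ε +
      (-(ℓ ^ ea D.ε * ℓ ^ eg D.ε / 24) + ((4 * D.nOf ℓ : ℕ) : ℝ) * (D.Cb + D.Cb * 2)) + (D.k₁Of ℓ : ℝ) * D.Cb with hZa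
  set Zb := 16 * D.Cb * D.kOf ℓ * ℓ + 10 * D.Cb * D.k₁Of ℓ * ℓ ^ dδ D.ε + -ℓ ^ eE D.ε with hZb
  have hprod : (|(D.S.d : ℝ)|) ^ (2 * D.nOf ℓ + D.k₁Of ℓ) * (Q.H : ℝ) ^ D.k₁Of ℓ * (D.run Q).U *
      ((3 * ((D.run Q).Q.H : ℝ) ^ 2 * (D.run Q).Bc ^ 2 * (D.run Q).Bc ^ 2) ^ ((D.run Q).S.G.h - 1) *
      (4 * (D.run Q).Q.H * (D.run Q).Bc * (D.run Q).Bc)) ≤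
      Real.exp Z * (3 * Real.exp Za + Real.exp Zb) := by
    calc _ = (|(D.S.d : ℝ)|) ^ (2 * D.nOf ℓ + D.k₁Of ℓ) * (Q.H : ℝ) ^ D.k₁Of ℓ *
          ((3 * ((D.run Q).Q.H : ℝ) ^ 2 * (D.run Q).Bc ^ 2 * (D.run Q).Bc ^ 2) ^ ((D.run Q).S.G.h - 1) *
          (4 * (D.run Q).Q.H * (D.run Q).Bc * (D.run Q).Bc)) * (D.run Q).U := by ring
      _ ≤ Real.exp Z * (3 * Real.exp Za + Real.exp Zb) := mul_le_mul hZW hU hU0 (by positivity)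
  refine lt_of_le_of_lt hprod ?_
  -- exponents
  obtain ⟨hnle, -, hN⟩ := n_bounds hL
  obtain ⟨hkle, -, -⟩ := k_bounds hL
  obtain ⟨hk₁le, -, hk₁1⟩ := k₁_bounds hL
  obtain ⟨-, -, hnk₁, -⟩ := params_order hL
  have hnk₁' : (D.nOf ℓ : ℝ) ≤ D.k₁Of ℓ := by exact_mod_cast hnk₁
  have hCb := D.one_le_Cb
  have hCb0 : 0 ≤ D.Cb := by linarith
  have hℓ := hL.hℓ
  have hℓ0 := ℓ_pos hL
  obtain ⟨hδ1, hδℓ⟩ := ℓδ_bounds hL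
  have hG3 := hL.hG3
  have hE3 := hL.hE3
  rw [rpow_add' hL, Real.rpow_one, rpow_add' hL] at hG3
  rw [rpow_add' hL, Real.rpow_one] at hE3
  have haa₁ : ℓ ^ ea D.ε ≤ ℓ ^ ea₁ D.ε := rpow_mono hL (D.exps).2.2.2.2.2.1
  -- everything is `≤ M = Cb² A₁ ℓ`
  have hA₁1 : 1 ≤ ℓ ^ ea₁ D.ε := by linarith [hL.h2a₁]
  have hM1 : 1 ≤ D.Cb ^ 2 * (ℓ ^ ea₁ D.ε * ℓ) :=
    one_le_mul_of_one_le_of_one_le (one_le_pow₀ hCb) (one_le_mul_of_one_le_of_one_le hA₁1 hℓ)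
  have hCb2 : D.Cb ≤ D.Cb ^ 2 := le_self_pow₀ hCb two_ne_zero
  have hk₁ℓ : (D.k₁Of ℓ : ℝ) * ℓ ≤ ℓ ^ ea₁ D.ε * ℓ := mul_le_mul_of_nonneg_right hk₁le hℓ0.le
  have v2 : (D.k₁Of ℓ : ℝ) * ℓ ≤ D.Cb ^ 2 * (ℓ ^ ea₁ D.ε * ℓ) :=
    hk₁ℓ.trans (le_mul_of_one_le_left (by positivity) (one_le_pow₀ hCb))
  have v3 : D.Cb ^ 2 * ((D.k₁Of ℓ : ℝ) * ℓ) ≤ D.Cb ^ 2 * (ℓ ^ ea₁ D.ε * ℓ) := mul_le_mul_of_nonneg_left hk₁ℓ (by positivity)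
  have v1 : D.Cb * ((D.k₁Of ℓ : ℝ) * ℓ) ≤ D.Cb ^ 2 * (ℓ ^ ea₁ D.ε * ℓ) := by
    have := mul_le_mul hCb2 hk₁ℓ (by positivity) (by positivity); linarith
  have v4 : D.Cb * (D.k₁Of ℓ : ℝ) ≤ D.Cb ^ 2 * (ℓ ^ ea₁ D.ε * ℓ) := by
    have : D.Cb * (D.k₁Of ℓ : ℝ) ≤ D.Cb * ((D.k₁Of ℓ : ℝ) * ℓ) := by
      have := le_mul_of_one_le_right (by positivity : 0 ≤ D.Cb * (D.k₁Of ℓ : ℝ)) hℓ; linarith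
    linarith
  have v5 : (D.k₁Of ℓ : ℝ) * ℓ ^ dδ D.ε ≤ D.Cb ^ 2 * (ℓ ^ ea₁ D.ε * ℓ) :=
    le_trans (mul_le_mul_of_nonneg_left hδℓ (by positivity)) v2
  have v6 : D.Cb * (D.nOf ℓ : ℝ) ≤ D.Cb ^ 2 * (ℓ ^ ea₁ D.ε * ℓ) := le_trans (mul_le_mul_of_nonneg_left hnk₁' hCb0) v4
  have hkk : (D.kOf ℓ : ℝ) ≤ D.k₁Of ℓ := by exact_mod_cast (params_order hL).2.1
  have v7 : D.Cb * ((D.kOf ℓ : ℝ) * ℓ) ≤ D.Cb ^ 2 * (ℓ ^ ea₁ D.ε * ℓ) :=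
    le_trans (mul_le_mul_of_nonneg_left (mul_le_mul_of_nonneg_right hkk hℓ0.le) hCb0) v1
  have v8 : D.Cb * ((D.k₁Of ℓ : ℝ) * ℓ ^ dδ D.ε) ≤ D.Cb ^ 2 * (ℓ ^ ea₁ D.ε * ℓ) :=
    le_trans (mul_le_mul_of_nonneg_left (mul_le_mul_of_nonneg_left hδℓ (by positivity)) hCb0) v1
  have hZle : Z ≤ 167 * (D.Cb ^ 2 * (ℓ ^ ea₁ D.ε * ℓ)) := by rw [hZ]; linarith [v1, v2, v3]
  have hAG0 : 0 ≤ ℓ ^ ea D.ε * ℓ ^ eg D.ε := by positivity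
  -- (a)
  have ea_le : Z + Za ≤ -2 := by rw [hZa]; push_cast; linarith [hZle, hG3, v4, v5, v6, hM1]
  -- (b)
  have eb_le : Z + Zb ≤ -2 := by rw [hZb]; linarith [hZle, hE3, v7, v8, hM1]
  obtain ⟨-, e2, -⟩ := exp_consts
  have hfin : Real.exp Z * (3 * Real.exp Za + Real.exp Zb) ≤ 4 * Real.exp (-2) := by
    have h1 : Real.exp Z * Real.exp Za ≤ Real.exp (-2) := by rw [← Real.exp_add]; exact Real.exp_le_exp.mpr ea_le
    have h2 : Real.exp Z * Real.exp Zb ≤ Real.exp (-2) := by rw [← Real.exp_add]; exact Real.exp_le_exp.mpr eb_le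
    linarith only [h1, h2]
  refine lt_of_le_of_lt hfin ?_
  rw [Real.exp_neg, ← div_eq_mul_inv, div_lt_one (Real.exp_pos 2)]
  exact e2


/-! #### All of `Run.Hyp` -/

/-- **Masser's parameters satisfy every inequality of the run** once `ℓ = log H` is large.
[cite: Masser1975, §1.3 ("if H > c for some sufficiently large c")] -/
theorem run_hyp (hdisc : Q.B ^ 2 - 4 * Q.A * Q.C < 0)
    (hmin : ∀ A' B' C' : ℤ, (A', B', C') ≠ (0, 0, 0) →
      (A' : ℂ) + (B' : ℂ) * Q.α + (C' : ℂ) * Q.α ^ 2 = 0 → (Q.H : ℤ) ≤ max |A'| (max |B'| |C'|))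
    (hclose : ‖D.S.L.ω₂ / D.S.L.ω₁ - Q.α‖ < D.Esm Q) : (D.run Q).Hyp where
  hdisc := hdisc
  hmin := hmin
  hE0 := Real.exp_pos _
  hE1 := by
    change Real.exp _ ≤ 1
    rw [Real.exp_le_one_iff, neg_nonpos]
    exact Real.rpow_nonneg (Real.log_nonneg (by exact_mod_cast Q.one_le_H)) _
  hclose := hclose
  hk := (k_bounds hL).2.2
  hkk₁ := (params_order hL).2.1
  hn := le_trans (Nat.le_succ _) (n_bounds hL).2.2
  hh := (h_bounds hL).2.2
  hh₁ := (h₁_bounds hL).2.2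
  hsiegel := hyp_siegel hL
  hP1 := hyp_P1 hL
  hP3 := hyp_P3 hL
  hBc := hyp_Bc
  hL1 := hyp_L1 hL
  hP4 := hyp_P4 hL
  hF := hyp_F hL

end RunBounds

end PData

/-! ### Theorem I -/

/-- **Masser's Theorem I** (LNM 437, Ch. I), in the quadratic case needed for Theorem II
(Lemma 2.2), with the height normalised to be exact: let `℘` have algebraic invariants and
`τ = ω₂/ω₁`; for every `ε > 0` (`≤ ½`) there is `H₀` such that for every complex quadratic
irrationality `α` — a root of `A + Bx + Cx²`, `B² - 4AC < 0`, `C ≠ 0`, `|A|, |B|, |C| ≤ H`, and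
`H` minimal among the heights of the integer quadratic relations of `α` — with `H ≥ H₀`,
`|τ - α| ≥ exp(-(log H)^{3+ε})`.
(Masser states `|τ - α| > C exp(-(log H)^{3+ε})` for all algebraic `α` of degree `≤ d`; the
constant is absorbed by `H ≥ H₀`, and complex multiplication is excluded automatically since
then `τ` itself would be such an `α`.) [cite: Masser1975, Theorem I (d = 2)] -/
theorem masser_thmI_quadratic (S : TSetup) {ε : ℝ} (hε : 0 < ε) (hε1 : ε ≤ 1 / 2) :
    ∃ H₀ : ℝ, ∀ Q : QData, H₀ ≤ Q.H → Q.B ^ 2 - 4 * Q.A * Q.C < 0 →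
      (∀ A' B' C' : ℤ, (A', B', C') ≠ (0, 0, 0) →
        (A' : ℂ) + (B' : ℂ) * Q.α + (C' : ℂ) * Q.α ^ 2 = 0 → (Q.H : ℤ) ≤ max |A'| (max |B'| |C'|)) →
      Real.exp (-(Real.log Q.H) ^ (3 + ε)) ≤ ‖S.L.ω₂ / S.L.ω₁ - Q.α‖ := by
  obtain ⟨K⟩ := exists_consts S.L
  let D : PData := ⟨S, K, ε, hε, hε1⟩
  obtain ⟨ℓ₀, hℓ₀⟩ := Filter.eventually_atTop.mp D.eventually_largeL
  refine ⟨Real.exp ℓ₀, fun Q hH hdisc hmin => ?_⟩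
  by_contra hlt
  rw [not_le] at hlt
  have hL : D.LargeL (Real.log Q.H) := hℓ₀ _ (by
    rw [← Real.log_exp ℓ₀]; exact Real.log_le_log (Real.exp_pos _) hH)
  exact (D.run Q).contradiction (PData.run_hyp hL hdisc hmin hlt)

end Literature.NumberTheory.Transcendental.Masser1975
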